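import Mathlib
import Literature.MathematicalPhysics.QuantumFieldTheory.Balaban1983to89.B6Prop26
import Literature.MathematicalPhysics.QuantumFieldTheory.Balaban1983to89.B6Cor28

/-!
# `Balaban1983to89.B6Prop26Norms` — [Balaban1984PropagatorsII] Proposition 2.6 (p. 247): the printed sentence
*"(2.141) … and the series above is convergent in the norms appearing in the inequalities (2.136)–(2.140)"*
KERNEL-CHECKED as bookkeeping for GENERAL input sizes and output norms and for RIGHT factors — the entry
|(G∇*J)(x)| of (2.136) and the shapes of (2.137)–(2.140)

CITATION HEADER (lean-in-tree rule 2026-08-18).  Source: T. Bałaban, *Propagators and renormalization transformations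
for lattice gauge theories. II*, Commun. Math. Phys. **96**, 223–250 (1984) [Balaban1984PropagatorsII] (cell paper B6;
held: `paper:balaban1984-cmp96-propagators-rt-ii`; journal page = PDF page + 222; quotations below are read from the
page renders pp. 234, 247).  Satellite of the sibling modules `…Balaban1983to89.B6` (unit r1 / b06), `…B6RandomWalk`
(unit pv08), `…B6Prop26` (unit pv01) and `…B6Cor28` (unit pv01), which it imports and does not modify; surge node
T03.6 (Prop. 2.6), located gap G-pv01-5 (iv) of the cell's GAPS.md, unit `b2b-balaban-pv01` (gen 2).

WHAT THE PAPER PRINTS.  p. 247 [PDF 25]: *"**Proposition 2.6.** There exists a positive constant δ₃ depending on d and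
L only, such that |(GJ)(x)|, |(∇GJ)(x)|, |(G∇*J)(x)|, |(ΔGJ)(x)| ≤ O(1)[(L^jη)², L^jη, L^jη, 1]e^{−δ₃d(y,y′)}|J| (2.136)
for x ∈ Δ(y), y ∈ Λ_j, supp J ⊂ Δ(y′), with the constant O(1) depending on d and L only; ‖ζ∇GJ‖_α, ‖ζG∇*J‖_α ≤
O(1)(L^jη)^{1−α}(‖ζ‖^ξ_α + |ζ|)e^{−δ₃d(y,y′)}|J|, ξ = L^{−j} (2.137) for 0 ≤ α < 1, ζ ∈ C₀^∞(Δ̃(y)) (the cube Δ̃(y)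
for y ∈ Λ_j is a sum of 2^d unit cubes on the L^{−j}-scale, having y as a corner), supp J ⊂ Δ(y′), with the constant
O(1) depending on d, L and α (O(1) → ∞ if α → 1); |(∇G∇*J)(x)| ≤ O(1)e^{−δ₃d(y,y′)}(‖J‖^{ξ′}_ε + |J|) (2.138) for
0 < ε < 1, x ∈ Δ(y), supp J ⊂ Δ̃(y′), y′ ∈ Λ_{j′}, ξ′ = L^{−j′}, with the constant O(1) depending on d, L, and ε
(O(1) → ∞ if ε → 0); ‖ζ∇G∇*J‖_α ≤ O(1)(L^jη)^{−α}(‖ζ‖^ξ_α + |ζ|)e^{−δ₃d(y,y′)}(‖J‖^{ξ′}_{α+ε} + |J|) (2.139) for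
0 ≤ α < 1, ε > 0, α + ε < 1, ζ ∈ C₀^∞(Δ̃(y)), supp J ⊂ Δ̃(y′), with the constant O(1) depending on d, L, α, and ε
(O(1) → ∞ if α → 1 or ε → 0); ‖ζGJ‖, ‖ζ∇GJ‖, ‖ζG∇*J‖, ‖ζ∇G∇*J‖, ‖ζ∇∇GJ‖, ‖ζG∇*∇*J‖ ≤ O(1)[(L^jη)², L^jη, L^jη,
1, 1, 1]|ζ|e^{−δ₃d(y,y′)}‖J‖ (2.140) if supp ζ ⊂ Δ(y), y ∈ Λ_j, supp J ⊂ Δ(y′), with the constant O(1) depending on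
d and L.  The operator G can be represented as G = G₀(I − R)^{−1} = Σ_{n=0}^∞ G₀Rⁿ = Σ_{ω=(□₀,…,□_{2n})}
h_{□₀}G_{□₀}h_{□₀} · K_{□₁,□₂}G_{□₂}h_{□₂} · … · K_{□_{2n−1},□_{2n}}G_{□_{2n}}h_{□_{2n}}, (2.141) and the series above
is convergent in the norms appearing in the inequalities (2.136)–(2.140)."*  The proposition is obtained *"Reasoning
in the same way as in the proof of Proposition 2.2"* (p. 247), i.e. by the chain (2.64)–(2.66) p. 234, after which
the paper prints (p. 234): *"The similar inequalities hold for a derivative of G′λ and for a Hölder norm of a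
derivative, but with (L^jη)² replaced by L^jη and (L^jη)^{1−α} correspondingly"* and, in Proposition 2.2 (whose table
(2.67) already lists |(G′∇*λ)(x)| and ‖ζG′∇*λ‖_α), *"The random walk representation (2.50) is convergent in the norms
defined by these inequalities."*  Nothing more is printed about the entries other than |(GJ)(x)|: the LOCAL bounds
for the boxes are those of Prop. 2.5 / (1.110)–(1.114) of [4] (p. 246), and the bounds of the operators
K_{□,□′}G_{□′}h_{□′} acting on the corresponding sources are covered by "the same way".

WHAT IS REPRODUCED HERE (kernel-checked; every analytic input an explicit hypothesis quoting its printed source; the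
tree's chain theorems `B6RandomWalk.majorant_pow_265`, `…fixedPoint_telescope`, `B6Prop26.fixedPoint_of_291`,
`B6Cor28.conv263_of_ineq263`, `B6Cor28.transfer_of_260` invoked BY NAME, not duplicated):
(0) THE COMMON SHAPE of (2.136)–(2.140), `GMajorant S N T K`: *"N_o(TJ) ≤ K(o,y′)·(size of J) whenever J is an
S-source at y′"* for a CLASS OF SOURCES S (localisation block y′ + one of the printed size functionals |J|,
‖J‖^{ξ′}_ε + |J|, ‖J‖) and a FAMILY OF OUTPUT SEMINORMS N (|·(x)|, ‖ζ∇·‖_α, ‖ζ·‖, …, Mathlib `Seminorm`); pv08's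
`HasMajorant` is the case sup sources × evaluations (`hasMajorant_iff`); LEFT factors are absorbed into N
(`gMajorant_comp_iff`); the (2.52) insertion Σ_yΔ(y) = I composes a (sup → N) majorant with an (S → sup) majorant
into an (S → N) majorant with the 𝔅-convolution kernel (`gMajorant_mul`; `gMajorant_add`, `gMajorant_sum`).
(A) `gMajorant_partialSums` / `gMajorant_of_fixedPoint` — the chain of the proof of Prop. 2.2 for ANY output seminorm
family: G′₀ of (sup → N) majorant A·P(o)·e^{−δ₀d}, R of (2.135)-majorant θe^{−δ₀d}, Lemma 2.1 at rate δ₀, (2.54),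
θc₁(α) < 1 ⟹ every partial sum of (2.141), and (finite lattice, G′ = G′₀ + G′R) G′ itself, has the (sup → N) majorant
A c₁(α)(1 − θc₁(α))^{−1}P(o)e^{−(1−α)δ₀d} — the quoted p. 234 sentence, hence the entries |∇GJ|, |ΔGJ| of (2.136),
‖ζ∇GJ‖_α of (2.137) and the left entries of (2.140) for sup sources (`prop26_leftEntry_of_291`, from (2.91)).
(B) `gMajorant_rightFactor` — RIGHT factors E (E = ∇*, ∇*∇*): G′E = G′₀E + G′(RE) (`right_mul_fixedPoint`), so an
(S → N) majorant K₀ of G′₀E (the n = 0 term) and an (S → sup) majorant K₂ of RE give the (S → N) majorant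
K₀ + Σ_{y″}K_G(o,y″)K₂(y″,y′) of G′E; with E = I the same passes G′ from sup sources to general sources.
(C) `rightFactor_kernel` — the kernel bookkeeping into the printed shape (model (2.88)): ONE scale transfer
P_G(o)Q(y″) ≤ Λe^{εd(y_o,y″)}P(o) ((2.60)) and ONE (2.63)-type convolution at a rate δ₀ with δ₀ + ε ≤ rate(K_G),
δ₀ ≤ rate(K₂), θ ≤ rate(K₀) ⟹ (A₀ + C_Gθ₂ΛC_c)·P(o)·e^{−θd(y_o,y′)}.
(D) `prop26_ioEntry_of_291` — EVERY entry of (2.136)–(2.140) in one statement (S, N, E arbitrary) from (2.91) with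
GΔ_a = I and the four located majorants (G₀: sup → N; R: (2.135); G₀E: S → N; RE: S → sup); `prop26_entry3_of_291` —
the printed entry |(G∇*J)(x)| ≤ O(1)L^jη e^{−δ₃d(y,y′)}|J| on pv08's carrier, the transfer derived from
L^jη ≤ Λe^{εd(y,y″)}L^{j″}η; `prop26_ioEntry_of_lemma21`, `prop26_entry3_of_lemma21` — the same over the carrier of
`…B6` with Lemma 2.1 TAKEN FROM THE TREE (`B6.Lemma21Printed`) at the rate δ of the majorants (parameter α) and at a
second rate r (parameter α′; the paper's successive halvings δ₂ → ½δ₂ → δ₃), (2.61)/(2.63)/(2.60) DISCHARGED, under the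
rate budget r + α′r ≤ (1−α)δ and the largeness L ≤ e^{α′rRM}; delivered δ₃ = (1−α′)r and
O(1) = A₀ + A c₁(d,δ,α)(1 − θc₁(d,δ,α))^{−1}θ₂·L·c₁(d,r,α′)², explicit; `prop26_table2136_of_lemma21` — the WHOLE
printed table (2.136) [(L^jη)², L^jη, L^jη, 1] = `B6.pref4` at once for sup sources (entries n ≠ 2 = left factors from
unit pv01's `B6Prop26.prop26_three_entries_of_lemma21`, entry n = 2 = the right factor E from
`prop26_entry3_of_lemma21`; common rate δ₃ = (1−α′)r ≤ (1−α)δ, common O(1) = A₀ + A c₁(1 − θc₁)^{−1}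
(1 + θ₂Lc₁(d,r,α′)²)).
(E) `rightFactor_fixedPoint_comm`, `prop26_ioEntry_comm_of_291`, `prop26_entry3_comm_of_291`,
`prop26_entry3_comm_of_lemma21` — a SECOND ARRANGEMENT for right factors, recorded because the "RE: S → sup" leaf of
(B)/(D) is delicate for E = ∇*: by (2.92) p. 239 [PDF 17], *"(K_{□,□}A)_μ(x) = Σ_{b∈st(x)}(∂h_□)(b)(∂A_μ)(b) −
(Δh_□)(x)A_μ(x) + …"*, RE contains ∂G_{□′}h_{□′}∇*, whose pointwise bound on sup-sized sources the paper itself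
prints only with a Hölder size ((2.138): ‖J‖^{ξ′}_ε + |J|, "O(1) → ∞ if ε → 0").  Under a located operator identity
RE = ER♯ + R♭ (moving that derivative onto the factor to the left) X = GE satisfies X = (G₀E + GR♭) + XR♯, of the
SAME shape as (2.141), and THEOREM A applies to X (Lemma 2.1 at a third rate).  Neither arrangement's leaves are
printed; both are offered as typed bookkeeping and the choice is the reader's (GAPS.md G-pv01-6).
WHAT IS *NOT* REPRODUCED OR ASSERTED: the four majorants themselves — (2.133)/(2.135) (hypotheses, as in `…B6Prop26`);
the n = 0 inputs "G₀E: S → N" for each entry (Prop. 2.5 = (1.110)–(1.114) of [4] for the boxes, summed over the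
partition {h_□}: the reader's, GAPS.md G-pv01-5 (i)); the "RE: S → sup" inputs |(K_{□,□′}G_{□′}h_{□′}∇*J)(x)| ≤
O(M^{−1})(L^jη)^{−1}e^{−½δ₂d(y,y′)}|J| and their analogues for Hölder / L² sources, resp. the decomposition
R∇* = ∇*R♯ + R♭ with its two sup majorants — NOT PRINTED (the paper's "the same way"; located leaves, GAPS.md G-pv01-6,
with the power of L^jη read at the OUTPUT block); the identification of the abstract seminorms N o with the paper's
‖ζ∇·‖_α, ‖ζ·‖ on the concrete lattice (no lattice Hölder norm is typed in the tree: `B6.Ineq2137_2139` keeps them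
opaque); "δ₃, O(1) depending on d and L only" beyond the explicit formulas.  NOTHING of Prop. 2.6 is asserted;
value = typed skeleton + located gaps, NOT summit progress.  Companion rows: cell `GAPS.md` G-pv01-5, G-pv01-6,
C-pv01-5; `DIVERGENCE.md` D-pv01.6; `SMALLNESS.md` S-B6.4 (rate budget r + α′r ≤ (1−α)δ, L ≤ e^{α′rRM}, θc₁ < 1).
-/

namespace Literature.MathematicalPhysics.QuantumFieldTheory.Balaban1983to89.B6Prop26Norms

open B6RandomWalk B6Prop26

/-- An admissible CLASS OF SOURCES: `mem y′ μ B` = "μ is a source localised at y′ ∈ 𝔅 of size at most B" with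
B ≥ 0 — the printed *"supp J ⊂ Δ(y′)"* (or Δ̃(y′)) together with ONE of the printed size functionals |J| ((2.136),
(2.137)), ‖J‖^{ξ′}_ε + |J| ((2.138), (2.139)), ‖J‖ ((2.140)). [cite: Balaban1984PropagatorsII, (2.136)–(2.140) p.247] -/
structure SourceClass (g : B6.Geometry) (X : Type) where
  mem : g.Site → (X → ℝ) → ℝ → Prop
  nonneg : ∀ {y' : g.Site} {μ : X → ℝ} {B : ℝ}, mem y' μ B → 0 ≤ B

section General

variable {g : B6.Geometry} {X : Type} {O : Type}

/-- The sup sources of (2.51)/(2.135)/(2.136): supp μ ⊂ Δ(y′), |μ| ≤ B (`B6RandomWalk.BlockSupp`, unit pv08).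
[cite: Balaban1984PropagatorsII, (2.135)–(2.136) p.247] -/
def blockSrc (blk : X → g.Site) : SourceClass g X where
  mem := fun y' μ B => BlockSupp blk μ y' B
  nonneg := fun h => h.nonneg

/-- The output functional |f(x)| of (2.136)/(2.138) as a (Mathlib) seminorm on the lattice functions. [folklore] -/
noncomputable def evalN (x : X) : Seminorm ℝ (X → ℝ) := (normSeminorm ℝ ℝ).comp (LinearMap.proj x)

/-- `evalN x f = |f x|`. [folklore] -/
@[simp] theorem evalN_apply (x : X) (f : X → ℝ) : evalN x f = |f x| := by
  simp [evalN, Seminorm.comp_apply, Real.norm_eq_abs]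

/-- **The common shape of (2.136)–(2.140)**: *"N_o(TJ) ≤ K(o, y′)·(size of J) for supp J ⊂ Δ(y′)"* — the operator T
has the MAJORANT K with respect to the source class S (input side) and the family of output seminorms N indexed by
o ∈ O (|·(x)| for x ∈ Δ(y): o = x; ‖ζ∇·‖_α, ‖ζ·‖ for supp ζ ⊂ Δ̃(y): o = (y, ζ); …).  pv08's `HasMajorant` is the
case S = sup sources, N = evaluation (`hasMajorant_iff`). [cite: Balaban1984PropagatorsII, (2.136)–(2.140) p.247] -/
def GMajorant (S : SourceClass g X) (N : O → Seminorm ℝ (X → ℝ)) (T : Module.End ℝ (X → ℝ))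
    (K : O → g.Site → ℝ) : Prop :=
  ∀ (y' : g.Site) (μ : X → ℝ) (B : ℝ), S.mem y' μ B → ∀ o : O, N o (T μ) ≤ K o y' * B

/-- `B6RandomWalk.HasMajorant blk T K` IS `GMajorant` for sup sources and the evaluation seminorms, with the kernel
read through the block map. [folklore] -/
theorem hasMajorant_iff (blk : X → g.Site) (T : Module.End ℝ (X → ℝ)) (K : g.Site → g.Site → ℝ) :
    HasMajorant blk T K ↔ GMajorant (blockSrc blk) evalN T (fun x => K (blk x)) := by
  simp only [HasMajorant, GMajorant, blockSrc, evalN_apply]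

/-- LEFT FACTORS ARE ABSORBED INTO THE OUTPUT NORMS: the majorant of D·T for the family N is the majorant of T for
the family N∘D (so |(∇GJ)(x)|, |(ΔGJ)(x)|, ‖ζ∇GJ‖_α are outputs of G itself). [folklore] -/
theorem gMajorant_comp_iff (S : SourceClass g X) (N : O → Seminorm ℝ (X → ℝ)) (D T : Module.End ℝ (X → ℝ))
    (K : O → g.Site → ℝ) :
    GMajorant S (fun o => (N o).comp (D : (X → ℝ) →ₗ[ℝ] (X → ℝ))) T K ↔ GMajorant S N (D * T) K := by
  simp only [GMajorant, Seminorm.comp_apply, Module.End.mul_apply]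

/-- Finite sums under a seminorm. [folklore] -/
theorem seminorm_sum_le {ι : Type} (p : Seminorm ℝ (X → ℝ)) (s : Finset ι) (f : ι → X → ℝ) :
    p (∑ i ∈ s, f i) ≤ ∑ i ∈ s, p (f i) := by
  classical
  induction s using Finset.induction_on with
  | empty => simp
  | insert a s ha ih =>
      rw [Finset.sum_insert ha, Finset.sum_insert ha]
      exact (map_add_le_add p _ _).trans (add_le_add le_rfl ih)

/-- Monotonicity of majorants (sizes are ≥ 0). [folklore] -/
theorem gMajorant_mono {S : SourceClass g X} {N : O → Seminorm ℝ (X → ℝ)} {T : Module.End ℝ (X → ℝ)}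
    {K K' : O → g.Site → ℝ} (h : GMajorant S N T K) (hle : ∀ o b, K o b ≤ K' o b) : GMajorant S N T K' :=
  fun y' μ B hμ o => (h y' μ B hμ o).trans (mul_le_mul_of_nonneg_right (hle _ _) (S.nonneg hμ))

/-- The zero operator. [folklore] -/
theorem gMajorant_zero (S : SourceClass g X) (N : O → Seminorm ℝ (X → ℝ)) :
    GMajorant S N (0 : Module.End ℝ (X → ℝ)) (fun _ _ => 0) := by
  intro y' μ B hμ o
  simp

/-- *"A summation preserves it also"* (p. 232). [cite: Balaban1984PropagatorsII, p.232] -/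
theorem gMajorant_add {S : SourceClass g X} {N : O → Seminorm ℝ (X → ℝ)} {T₁ T₂ : Module.End ℝ (X → ℝ)}
    {K₁ K₂ : O → g.Site → ℝ} (h₁ : GMajorant S N T₁ K₁) (h₂ : GMajorant S N T₂ K₂) :
    GMajorant S N (T₁ + T₂) (fun o b => K₁ o b + K₂ o b) := by
  intro y' μ B hμ o
  rw [LinearMap.add_apply, add_mul]
  exact (map_add_le_add (N o) _ _).trans (add_le_add (h₁ y' μ B hμ o) (h₂ y' μ B hμ o))

/-- Finite sums of operators. [folklore] -/
theorem gMajorant_sum {S : SourceClass g X} {N : O → Seminorm ℝ (X → ℝ)} (T : ℕ → Module.End ℝ (X → ℝ))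
    (K : ℕ → O → g.Site → ℝ) (h : ∀ n, GMajorant S N (T n) (K n)) (M : ℕ) :
    GMajorant S N (∑ n ∈ Finset.range M, T n) (fun o b => ∑ n ∈ Finset.range M, K n o b) := by
  induction M with
  | zero => simpa using gMajorant_zero S N
  | succ M ih =>
      have := gMajorant_add ih (h M)
      simpa [Finset.sum_range_succ] using this

/-- **(2.52), the insertion Σ_{y∈𝔅} Δ(y) = I between two factors** (p. 232: *"this property is preserved under the
composition of operators possessing it"*), for general norms: if T₁ takes sup sources to N-outputs with majorant K₁
and T₂ takes S-sources to sup outputs with majorant K₂ ≥ 0 (read through the block map), then T₁T₂ takes S-sources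
to N-outputs with the 𝔅-convolution Σ_{y″} K₁(o,y″)K₂(y″,y′). [cite: Balaban1984PropagatorsII, (2.52)–(2.55) p.232] -/
theorem gMajorant_mul (blk : X → g.Site) {S : SourceClass g X} {N : O → Seminorm ℝ (X → ℝ)}
    {T₁ T₂ : Module.End ℝ (X → ℝ)} {K₁ : O → g.Site → ℝ} {K₂ : g.Site → g.Site → ℝ}
    (h₁ : GMajorant (blockSrc blk) N T₁ K₁) (h₂ : GMajorant S evalN T₂ (fun x => K₂ (blk x)))
    (hK₂ : ∀ a b, 0 ≤ K₂ a b) :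
    GMajorant S N (T₁ * T₂) (fun o b => ∑ y'' : g.Site, K₁ o y'' * K₂ y'' b) := by
  intro y' μ B hμ o
  have hB : 0 ≤ B := S.nonneg hμ
  have hν : ∀ x, |T₂ μ x| ≤ K₂ (blk x) y' * B := fun x => by simpa using h₂ y' μ B hμ x
  have hpiece : ∀ y'' : g.Site, N o (T₁ (blockPiece blk y'' (T₂ μ))) ≤ K₁ o y'' * (K₂ y'' y' * B) :=
    fun y'' => h₁ y'' (blockPiece blk y'' (T₂ μ)) (K₂ y'' y' * B)
      (blockSupp_blockPiece blk (T₂ μ) y'' (K₂ y'' y' * B) (mul_nonneg (hK₂ _ _) hB)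
        (fun x' hx' => by simpa [hx'] using hν x')) o
  rw [Module.End.mul_apply]
  conv_lhs => rw [← sum_blockPiece blk (T₂ μ), map_sum]
  refine (seminorm_sum_le (N o) _ _).trans ?_
  rw [Finset.sum_mul]
  refine Finset.sum_le_sum fun y'' _ => ?_
  simpa [mul_assoc] using hpiece y''

/-- Every seminorm of a linear image is bounded by the sup norm on a FINITE lattice: N(Tμ) ≤ E·sup|μ| (expand μ in
point masses).  Used only to pass to the limit in (2.141). [folklore] -/
theorem seminorm_opBound [Fintype X] [DecidableEq X] (p : Seminorm ℝ (X → ℝ)) (T : Module.End ℝ (X → ℝ)) :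
    ∃ E : ℝ, 0 ≤ E ∧ ∀ (μ : X → ℝ) (B : ℝ), 0 ≤ B → (∀ x, |μ x| ≤ B) → p (T μ) ≤ E * B := by
  refine ⟨∑ x' : X, p (T (Pi.single x' 1)), Finset.sum_nonneg fun _ _ => apply_nonneg _ _,
    fun μ B hB hμ => ?_⟩
  have hdec : μ = ∑ x' : X, μ x' • (Pi.single x' (1 : ℝ) : X → ℝ) := by
    funext z
    rw [Finset.sum_apply]
    simp [Pi.single_apply]
  have hTμ : T μ = ∑ x' : X, μ x' • T (Pi.single x' 1) := by
    conv_lhs => rw [hdec, map_sum]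
    exact Finset.sum_congr rfl fun x' _ => by rw [map_smul]
  rw [hTμ]
  calc p (∑ x' : X, μ x' • T (Pi.single x' 1))
      ≤ ∑ x' : X, p (μ x' • T (Pi.single x' 1)) := seminorm_sum_le p _ _
    _ = ∑ x' : X, |μ x'| * p (T (Pi.single x' 1)) :=
        Finset.sum_congr rfl fun x' _ => by rw [map_smul_eq_mul, Real.norm_eq_abs]
    _ ≤ ∑ x' : X, B * p (T (Pi.single x' 1)) :=
        Finset.sum_le_sum fun x' _ => mul_le_mul_of_nonneg_right (hμ x') (apply_nonneg _ _)
    _ = (∑ x' : X, p (T (Pi.single x' 1))) * B := by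
        rw [Finset.sum_mul]; exact Finset.sum_congr rfl fun _ _ => mul_comm _ _

/-- The y″-summation of (2.66) as a pure kernel inequality: `Σ_{y″} e^{−δ₀d(a,y″)} e^{−(1−α)δ₀d(y″,b)} ≤ c₁(α)
e^{−(1−α)δ₀d(a,b)}` — split e^{−δ₀d(a,y″)} = e^{−(1−α)δ₀d(a,y″)}e^{−αδ₀d(a,y″)}, use the triangle inequality (2.54)
on the (1−α)-parts and (2.61) on the α-part. [cite: Balaban1984PropagatorsII, (2.66) p.234 with (2.54), (2.61)] -/
theorem sum_kernel_266 (d : ℕ) (δ₀ α : ℝ) (hαδ : 0 ≤ (1 - α) * δ₀) (htri : Triangle254 g)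
    (h261 : Ineq261 d g δ₀ α) (a b : g.Site) :
    ∑ y'' : g.Site, Real.exp (-(δ₀ * g.dist a y'')) * Real.exp (-((1 - α) * δ₀ * g.dist y'' b)) ≤
      B6.c1 d δ₀ α * Real.exp (-((1 - α) * δ₀ * g.dist a b)) := by
  have hterm : ∀ y'' : g.Site, Real.exp (-(δ₀ * g.dist a y'')) * Real.exp (-((1 - α) * δ₀ * g.dist y'' b)) ≤
      Real.exp (-((1 - α) * δ₀ * g.dist a b)) * Real.exp (-(α * δ₀ * g.dist a y'')) := by
    intro y''
    rw [← Real.exp_add, ← Real.exp_add]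
    refine Real.exp_le_exp.mpr ?_
    have := mul_le_mul_of_nonneg_left (htri a y'' b) hαδ
    nlinarith
  calc ∑ y'' : g.Site, Real.exp (-(δ₀ * g.dist a y'')) * Real.exp (-((1 - α) * δ₀ * g.dist y'' b))
      ≤ ∑ y'' : g.Site, Real.exp (-((1 - α) * δ₀ * g.dist a b)) * Real.exp (-(α * δ₀ * g.dist a y'')) :=
        Finset.sum_le_sum fun y'' _ => hterm y''
    _ = Real.exp (-((1 - α) * δ₀ * g.dist a b)) * ∑ y'' : g.Site, Real.exp (-(α * δ₀ * g.dist a y'')) := by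
        rw [Finset.mul_sum]
    _ ≤ Real.exp (-((1 - α) * δ₀ * g.dist a b)) * B6.c1 d δ₀ α :=
        mul_le_mul_of_nonneg_left (h261 a) (Real.exp_nonneg _)
    _ = B6.c1 d δ₀ α * Real.exp (-((1 - α) * δ₀ * g.dist a b)) := mul_comm _ _

/-- **The partial sums of (2.141) are bounded UNIFORMLY in every output norm** ((2.65)–(2.66) of the proof of
Prop. 2.2, for a general family N of output seminorms): if G′₀ takes sup sources to N-outputs with majorant
A·P(o)·e^{−δ₀d(y_o,y′)} (y_o = `oblk o` the output block; P(o) = (L^jη)², L^jη, (L^jη)^{1−α}(‖ζ‖^ξ_α + |ζ|), 1, …)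
and R has the (2.135)-majorant θe^{−δ₀d(y,y′)}, then under Lemma 2.1 at rate δ₀ ((2.61), (2.63)), (2.54), d(y,y) = 0
and θc₁(α) < 1 every partial sum Σ_{n<M} G′₀Rⁿ takes sup sources to N-outputs with the SAME majorant
A c₁(α)(1 − θc₁(α))^{−1} P(o) e^{−(1−α)δ₀d(y_o,y′)} — the content of *"the series above is convergent in the norms
appearing in the inequalities (2.136)–(2.140)"* on the majorant side.
[cite: Balaban1984PropagatorsII, (2.141) p.247; (2.65)–(2.66) p.234] -/
theorem gMajorant_partialSums (blk : X → g.Site) (N : O → Seminorm ℝ (X → ℝ)) (oblk : O → g.Site) (d : ℕ)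
    (δ₀ α θ A : ℝ) (P : O → ℝ) (hA : 0 ≤ A) (hP : ∀ o, 0 ≤ P o) (hθ : 0 ≤ θ) (hαδ : 0 ≤ (1 - α) * δ₀)
    (htri : Triangle254 g) (hrefl : ∀ y : g.Site, g.dist y y = 0) (h261 : Ineq261 d g δ₀ α)
    (h263 : Ineq263 d g δ₀ α) (hsmall : θ * B6.c1 d δ₀ α < 1) {G0 R : Module.End ℝ (X → ℝ)}
    (hG0 : GMajorant (blockSrc blk) N G0 (fun o b => A * P o * Real.exp (-(δ₀ * g.dist (oblk o) b))))
    (hR : HasMajorant blk R (fun a b => θ * Real.exp (-(δ₀ * g.dist a b)))) (M : ℕ) :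
    GMajorant (blockSrc blk) N (∑ n ∈ Finset.range M, G0 * R ^ n)
      (fun o b => A * B6.c1 d δ₀ α * (1 - θ * B6.c1 d δ₀ α)⁻¹ * P o *
        Real.exp (-((1 - α) * δ₀ * g.dist (oblk o) b))) := by
  set q : ℝ := θ * B6.c1 d δ₀ α with hq
  have hq0 : 0 ≤ q := mul_nonneg hθ (c1_nonneg d δ₀ α)
  -- (2.65): Rⁿ takes sup sources to sup outputs with majorant qⁿ e^{−(1−α)δ₀ d}
  have hRn : ∀ n : ℕ, GMajorant (blockSrc blk) evalN (R ^ n)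
      (fun x b => q ^ n * Real.exp (-((1 - α) * δ₀ * g.dist (blk x) b))) := fun n =>
    (hasMajorant_iff blk (R ^ n) _).mp (majorant_pow_265 blk d δ₀ α θ hθ hrefl h263 hR n)
  -- one term G′₀Rⁿ of (2.66)
  have hterm : ∀ n : ℕ, GMajorant (blockSrc blk) N (G0 * R ^ n)
      (fun o b => A * B6.c1 d δ₀ α * P o * q ^ n * Real.exp (-((1 - α) * δ₀ * g.dist (oblk o) b))) := by
    intro n
    refine gMajorant_mono (gMajorant_mul blk
      (K₂ := fun a b => q ^ n * Real.exp (-((1 - α) * δ₀ * g.dist a b))) hG0 (hRn n)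
      (fun a b => mul_nonneg (pow_nonneg hq0 n) (Real.exp_nonneg _))) fun o b => ?_
    have hs := sum_kernel_266 d δ₀ α hαδ htri h261 (oblk o) b
    have hC : 0 ≤ A * P o * q ^ n := mul_nonneg (mul_nonneg hA (hP o)) (pow_nonneg hq0 n)
    calc ∑ y'' : g.Site, A * P o * Real.exp (-(δ₀ * g.dist (oblk o) y'')) *
          (q ^ n * Real.exp (-((1 - α) * δ₀ * g.dist y'' b)))
        = A * P o * q ^ n * ∑ y'' : g.Site, Real.exp (-(δ₀ * g.dist (oblk o) y'')) *
            Real.exp (-((1 - α) * δ₀ * g.dist y'' b)) := by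
          rw [Finset.mul_sum]; exact Finset.sum_congr rfl fun _ _ => by ring
      _ ≤ A * P o * q ^ n * (B6.c1 d δ₀ α * Real.exp (-((1 - α) * δ₀ * g.dist (oblk o) b))) :=
          mul_le_mul_of_nonneg_left hs hC
      _ = _ := by ring
  -- sum over n < M with the geometric series Σ qⁿ ≤ (1 − q)^{−1}
  refine gMajorant_mono (gMajorant_sum _ _ hterm M) fun o b => ?_
  have hgeom : ∑ n ∈ Finset.range M, q ^ n ≤ (1 - q)⁻¹ :=
    sum_le_hasSum (Finset.range M) (fun n _ => pow_nonneg hq0 n) (hasSum_geometric_of_lt_one hq0 hsmall)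
  have hC : 0 ≤ A * B6.c1 d δ₀ α * P o * Real.exp (-((1 - α) * δ₀ * g.dist (oblk o) b)) :=
    mul_nonneg (mul_nonneg (mul_nonneg hA (c1_nonneg d δ₀ α)) (hP o)) (Real.exp_nonneg _)
  calc ∑ n ∈ Finset.range M, A * B6.c1 d δ₀ α * P o * q ^ n * Real.exp (-((1 - α) * δ₀ * g.dist (oblk o) b))
      = A * B6.c1 d δ₀ α * P o * Real.exp (-((1 - α) * δ₀ * g.dist (oblk o) b)) *
          ∑ n ∈ Finset.range M, q ^ n := by
        rw [Finset.mul_sum]; exact Finset.sum_congr rfl fun _ _ => by ring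
    _ ≤ A * B6.c1 d δ₀ α * P o * Real.exp (-((1 - α) * δ₀ * g.dist (oblk o) b)) * (1 - q)⁻¹ :=
        mul_le_mul_of_nonneg_left hgeom hC
    _ = _ := by ring

/-- **THEOREM A — the chain of the proof of Prop. 2.2 ((2.50)/(2.64)–(2.66)) for a GENERAL family of output
seminorms.**  On a finite lattice with block map to 𝔅: if G′ = G′₀ + G′R ((2.141) via (2.91)), G′₀ takes sup sources
to N-outputs with majorant A·P(o)·e^{−δ₀d(y_o,y′)}, R has the (2.135)-majorant θe^{−δ₀d(y,y′)}, Lemma 2.1 holds at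
rate δ₀ ((2.61), (2.63)), (2.54), d(y,y) = 0, d ≥ 0 and θc₁(α) < 1, then G′ ITSELF takes sup sources to N-outputs with
majorant A c₁(α)(1 − θc₁(α))^{−1} P(o) e^{−(1−α)δ₀ d(y_o,y′)}: the partial sums are bounded uniformly
(`gMajorant_partialSums`) and the remainder G′R^M is killed as M → ∞ by (2.65) and the finiteness of the lattice
(`seminorm_opBound`).  For N = |·(x)| this is `B6RandomWalk.majorant_of_fixedPoint_266` (unit pv08); left factors
∇, Δ, ζ∇ are absorbed into N (`gMajorant_comp_iff`), so this covers *"The similar inequalities hold for a derivative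
of G′λ and for a Hölder norm of a derivative, but with (L^jη)² replaced by L^jη and (L^jη)^{1−α} correspondingly"*
(p. 234): the entries |∇GJ|, |ΔGJ| of (2.136), ‖ζ∇GJ‖_α of (2.137) and the LEFT entries of (2.140), for sup sources.
[cite: Balaban1984PropagatorsII, Prop. 2.6 (2.141) p.247; Prop. 2.2 (2.64)–(2.67) p.234] -/
theorem gMajorant_of_fixedPoint [Fintype X] [DecidableEq X] (blk : X → g.Site) (N : O → Seminorm ℝ (X → ℝ))
    (oblk : O → g.Site) (d : ℕ) (δ₀ α θ A : ℝ) (P : O → ℝ)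
    (hA : 0 ≤ A) (hP : ∀ o, 0 ≤ P o) (hθ : 0 ≤ θ) (hαδ : 0 ≤ (1 - α) * δ₀) (htri : Triangle254 g)
    (hrefl : ∀ y : g.Site, g.dist y y = 0) (hdnn : ∀ y y' : g.Site, 0 ≤ g.dist y y')
    (h261 : Ineq261 d g δ₀ α) (h263 : Ineq263 d g δ₀ α) (hsmall : θ * B6.c1 d δ₀ α < 1)
    {G' G0 R : Module.End ℝ (X → ℝ)}
    (hG0 : GMajorant (blockSrc blk) N G0 (fun o b => A * P o * Real.exp (-(δ₀ * g.dist (oblk o) b))))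
    (hR : HasMajorant blk R (fun a b => θ * Real.exp (-(δ₀ * g.dist a b)))) (hfix : G' = G0 + G' * R) :
    GMajorant (blockSrc blk) N G'
      (fun o b => A * B6.c1 d δ₀ α * (1 - θ * B6.c1 d δ₀ α)⁻¹ * P o *
        Real.exp (-((1 - α) * δ₀ * g.dist (oblk o) b))) := by
  have hpartial := gMajorant_partialSums blk N oblk d δ₀ α θ A P hA hP hθ hαδ htri hrefl h261 h263 hsmall hG0 hR
  set q : ℝ := θ * B6.c1 d δ₀ α with hq
  have hq0 : 0 ≤ q := mul_nonneg hθ (c1_nonneg d δ₀ α)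
  have hRn : ∀ n : ℕ, GMajorant (blockSrc blk) evalN (R ^ n)
      (fun x b => q ^ n * Real.exp (-((1 - α) * δ₀ * g.dist (blk x) b))) := fun n =>
    (hasMajorant_iff blk (R ^ n) _).mp (majorant_pow_265 blk d δ₀ α θ hθ hrefl h263 hR n)
  -- the remainder G′R^M → 0 (M → ∞)
  intro y' μ B hμ o
  obtain ⟨E, -, hEb⟩ := seminorm_opBound (N o) G'
  have hB : 0 ≤ B := (blockSrc blk).nonneg hμ
  set C : ℝ := A * B6.c1 d δ₀ α * (1 - q)⁻¹ * P o * Real.exp (-((1 - α) * δ₀ * g.dist (oblk o) y')) * B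
    with hC
  have hM : ∀ M : ℕ, N o (G' μ) ≤ C + E * B * q ^ M := by
    intro M
    have hS := hpartial M y' μ B hμ o
    have hsup : ∀ z, |(R ^ M) μ z| ≤ q ^ M * B := fun z => by
      have h1 := hRn M y' μ B hμ z
      rw [evalN_apply] at h1
      refine h1.trans (mul_le_mul_of_nonneg_right ?_ hB)
      have : Real.exp (-((1 - α) * δ₀ * g.dist (blk z) y')) ≤ 1 := by
        rw [Real.exp_le_one_iff]
        have := mul_nonneg hαδ (hdnn (blk z) y')
        linarith
      simpa using mul_le_mul_of_nonneg_left this (pow_nonneg hq0 M)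
    have hrem : N o ((G' * R ^ M) μ) ≤ E * (q ^ M * B) := by
      rw [Module.End.mul_apply]
      exact hEb _ _ (mul_nonneg (pow_nonneg hq0 M) hB) hsup
    have hsplit : G' μ = (∑ n ∈ Finset.range M, G0 * R ^ n) μ + (G' * R ^ M) μ := by
      conv_lhs => rw [fixedPoint_telescope hfix M]
      rfl
    rw [hsplit]
    refine (map_add_le_add (N o) _ _).trans ?_
    have h1 : N o ((∑ n ∈ Finset.range M, G0 * R ^ n) μ) ≤ C := by simpa [hC, hq] using hS
    nlinarith [hrem, h1]
  have hlim : Filter.Tendsto (fun M : ℕ => C + E * B * q ^ M) Filter.atTop (nhds (C + E * B * 0)) :=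
    ((tendsto_pow_atTop_nhds_zero_of_lt_one hq0 hsmall).const_mul (E * B)).const_add C
  rw [mul_zero, add_zero] at hlim
  have := ge_of_tendsto' hlim hM
  simpa [hC, hq] using this

/-! ## Right factors and general sources: G E = G₀E + G(RE) -/

/-- Right factors: `G′ = G′₀ + G′R` gives `G′E = G′₀E + G′(RE)` for every linear E (E = ∇*, ∇*∇* — the entries
|(G∇*J)(x)| of (2.136), ‖ζG∇*J‖_α of (2.137), (2.138), (2.139), ‖ζG∇*J‖, ‖ζ∇G∇*J‖, ‖ζG∇*∇*J‖ of (2.140): in the series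
(2.141) applied to E J the LAST factor changes). [folklore] -/
theorem right_mul_fixedPoint {G' G0 R : Module.End ℝ (X → ℝ)} (E : Module.End ℝ (X → ℝ))
    (hfix : G' = G0 + G' * R) : G' * E = G0 * E + G' * (R * E) := by
  conv_lhs => rw [hfix]
  rw [add_mul, mul_assoc]

/-- **THEOREM B — the series (2.141) applied to E J, in general norms.**  If G′ = G′₀ + G′R, G′ takes sup sources to
N-outputs with majorant K_G (THEOREM A), G′₀E takes S-sources to N-outputs with majorant K₀ (the n = 0 term: the LOCAL
bound of Prop. 2.5 / (1.110)–(1.114) of [4] for the entry in question, summed over the boxes) and RE takes S-sources to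
sup outputs with majorant K₂ ≥ 0 (the terms n ≥ 1: G′₀Rⁿ⁻¹·(RE)), then G′E takes S-sources to N-outputs with majorant
K₀ + Σ_{y″} K_G(o,y″)K₂(y″,y′).  With E = I this is also the passage from sup sources to GENERAL sources for G′ itself
(the L² entries ‖ζGJ‖, ‖ζ∇GJ‖, ‖ζ∇∇GJ‖ ≤ …‖J‖ of (2.140)). [cite: Balaban1984PropagatorsII, Prop. 2.6 (2.141) p.247] -/
theorem gMajorant_rightFactor (blk : X → g.Site) {S : SourceClass g X} {N : O → Seminorm ℝ (X → ℝ)}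
    {G' G0 R : Module.End ℝ (X → ℝ)} (E : Module.End ℝ (X → ℝ)) (hfix : G' = G0 + G' * R)
    {KG K0 : O → g.Site → ℝ} (K2 : g.Site → g.Site → ℝ)
    (hG : GMajorant (blockSrc blk) N G' KG) (hG0E : GMajorant S N (G0 * E) K0)
    (hRE : GMajorant S evalN (R * E) (fun x => K2 (blk x))) (hK2 : ∀ a b, 0 ≤ K2 a b) :
    GMajorant S N (G' * E) (fun o b => K0 o b + ∑ y'' : g.Site, KG o y'' * K2 y'' b) := by
  rw [right_mul_fixedPoint E hfix]
  exact gMajorant_add hG0E (gMajorant_mul blk (K₂ := K2) hG hRE hK2)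

/-- **THEOREM C — the kernel bookkeeping of THEOREM B into the printed shape** (model: (2.88) p. 238).  Over a finite
multiscale set with a distance d ≥ 0: the n = 0 kernel A₀P(o)e^{−δ_a d(y_o,y′)}, the G′-kernel
C_G P_G(o)e^{−δ_b d(y_o,y″)} and the RE-kernel θ₂Q(y″)e^{−δ_c d(y″,y′)}, with ONE scale transfer
`P_G(o)Q(y″) ≤ Λ e^{ε d(y_o,y″)} P(o)` (the mismatched powers of L^jη at the intermediate point moved to the output
point, (2.60)) and the (2.63)-type convolution Σ_{y″} e^{−δ₀d(y_o,y″)}e^{−δ₀d(y″,y′)} ≤ C_c e^{−θd(y_o,y′)} at a rate δ₀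
with δ₀ + ε ≤ δ_b, δ₀ ≤ δ_c, θ ≤ δ_a, sum to at most (A₀ + C_Gθ₂ΛC_c)·P(o)·e^{−θ d(y_o,y′)}.
[cite: Balaban1984PropagatorsII, Prop. 2.6 p.247 with (2.88) p.238, (2.60)/(2.63) p.234] -/
theorem rightFactor_kernel {S' : Type} [Fintype S'] (dist : S' → S' → ℝ) (oblk : O → S') (P PG : O → ℝ)
    (Q : S' → ℝ) (A₀ CG θ₂ Λ ε δa δb δc δ₀ Cc θ : ℝ)
    (hA₀ : 0 ≤ A₀) (hCG : 0 ≤ CG) (hθ₂ : 0 ≤ θ₂) (hΛ : 0 ≤ Λ) (hP : ∀ o, 0 ≤ P o) (hPG : ∀ o, 0 ≤ PG o)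
    (hQ : ∀ y, 0 ≤ Q y) (hdist : ∀ a b, 0 ≤ dist a b)
    (htransfer : ∀ o y'', PG o * Q y'' ≤ Λ * Real.exp (ε * dist (oblk o) y'') * P o)
    (hδb : δ₀ + ε ≤ δb) (hδc : δ₀ ≤ δc) (hδa : θ ≤ δa) (hConv : B6Cor28.Conv263 dist δ₀ Cc θ)
    (o : O) (b : S') :
    A₀ * P o * Real.exp (-(δa * dist (oblk o) b)) +
        ∑ y'' : S', (CG * PG o * Real.exp (-(δb * dist (oblk o) y''))) *
          (θ₂ * Q y'' * Real.exp (-(δc * dist y'' b))) ≤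
      (A₀ + CG * θ₂ * Λ * Cc) * P o * Real.exp (-(θ * dist (oblk o) b)) := by
  have h1 : A₀ * P o * Real.exp (-(δa * dist (oblk o) b)) ≤ A₀ * P o * Real.exp (-(θ * dist (oblk o) b)) :=
    mul_le_mul_of_nonneg_left (B6Cor28.exp_weaken_le δa θ _ hδa (hdist _ _)) (mul_nonneg hA₀ (hP o))
  have hterm : ∀ y'' : S', (CG * PG o * Real.exp (-(δb * dist (oblk o) y''))) *
        (θ₂ * Q y'' * Real.exp (-(δc * dist y'' b))) ≤
      CG * θ₂ * Λ * P o * (Real.exp (-(δ₀ * dist (oblk o) y'')) * Real.exp (-(δ₀ * dist y'' b))) := by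
    intro y''
    have hsplit : Real.exp (-(δb * dist (oblk o) y'')) ≤
        Real.exp (-(ε * dist (oblk o) y'')) * Real.exp (-(δ₀ * dist (oblk o) y'')) :=
      B6Cor28.exp_split_le δb ε δ₀ _ hδb (hdist _ _)
    have hweak : Real.exp (-(δc * dist y'' b)) ≤ Real.exp (-(δ₀ * dist y'' b)) :=
      B6Cor28.exp_weaken_le δc δ₀ _ hδc (hdist _ _)
    have hPQ : PG o * Q y'' * Real.exp (-(ε * dist (oblk o) y'')) ≤ Λ * P o := by
      have hexp : Real.exp (ε * dist (oblk o) y'') * Real.exp (-(ε * dist (oblk o) y'')) = 1 := by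
        rw [← Real.exp_add]; simp
      calc PG o * Q y'' * Real.exp (-(ε * dist (oblk o) y''))
          ≤ (Λ * Real.exp (ε * dist (oblk o) y'') * P o) * Real.exp (-(ε * dist (oblk o) y'')) :=
            mul_le_mul_of_nonneg_right (htransfer o y'') (Real.exp_nonneg _)
        _ = Λ * P o * (Real.exp (ε * dist (oblk o) y'') * Real.exp (-(ε * dist (oblk o) y''))) := by ring
        _ = Λ * P o := by rw [hexp, mul_one]
    have hA : PG o * Q y'' * Real.exp (-(δb * dist (oblk o) y'')) ≤
        Λ * P o * Real.exp (-(δ₀ * dist (oblk o) y'')) := by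
      calc PG o * Q y'' * Real.exp (-(δb * dist (oblk o) y''))
          ≤ PG o * Q y'' * (Real.exp (-(ε * dist (oblk o) y'')) * Real.exp (-(δ₀ * dist (oblk o) y''))) :=
            mul_le_mul_of_nonneg_left hsplit (mul_nonneg (hPG o) (hQ y''))
        _ = (PG o * Q y'' * Real.exp (-(ε * dist (oblk o) y''))) * Real.exp (-(δ₀ * dist (oblk o) y'')) := by
            ring
        _ ≤ (Λ * P o) * Real.exp (-(δ₀ * dist (oblk o) y'')) :=
            mul_le_mul_of_nonneg_right hPQ (Real.exp_nonneg _)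
    have hB : (Λ * P o * Real.exp (-(δ₀ * dist (oblk o) y''))) * Real.exp (-(δc * dist y'' b)) ≤
        (Λ * P o * Real.exp (-(δ₀ * dist (oblk o) y''))) * Real.exp (-(δ₀ * dist y'' b)) :=
      mul_le_mul_of_nonneg_left hweak (mul_nonneg (mul_nonneg hΛ (hP o)) (Real.exp_nonneg _))
    calc (CG * PG o * Real.exp (-(δb * dist (oblk o) y''))) * (θ₂ * Q y'' * Real.exp (-(δc * dist y'' b)))
        = CG * θ₂ * ((PG o * Q y'' * Real.exp (-(δb * dist (oblk o) y''))) * Real.exp (-(δc * dist y'' b))) := by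
          ring
      _ ≤ CG * θ₂ * ((Λ * P o * Real.exp (-(δ₀ * dist (oblk o) y''))) * Real.exp (-(δc * dist y'' b))) :=
          mul_le_mul_of_nonneg_left (mul_le_mul_of_nonneg_right hA (Real.exp_nonneg _)) (mul_nonneg hCG hθ₂)
      _ ≤ CG * θ₂ * ((Λ * P o * Real.exp (-(δ₀ * dist (oblk o) y''))) * Real.exp (-(δ₀ * dist y'' b))) :=
          mul_le_mul_of_nonneg_left hB (mul_nonneg hCG hθ₂)
      _ = CG * θ₂ * Λ * P o * (Real.exp (-(δ₀ * dist (oblk o) y'')) * Real.exp (-(δ₀ * dist y'' b))) := by ring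
  have hC : 0 ≤ CG * θ₂ * Λ * P o := mul_nonneg (mul_nonneg (mul_nonneg hCG hθ₂) hΛ) (hP o)
  calc A₀ * P o * Real.exp (-(δa * dist (oblk o) b)) +
        ∑ y'' : S', (CG * PG o * Real.exp (-(δb * dist (oblk o) y''))) *
          (θ₂ * Q y'' * Real.exp (-(δc * dist y'' b)))
      ≤ A₀ * P o * Real.exp (-(θ * dist (oblk o) b)) +
          ∑ y'' : S', CG * θ₂ * Λ * P o * (Real.exp (-(δ₀ * dist (oblk o) y'')) * Real.exp (-(δ₀ * dist y'' b))) :=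
        add_le_add h1 (Finset.sum_le_sum fun y'' _ => hterm y'')
    _ = A₀ * P o * Real.exp (-(θ * dist (oblk o) b)) +
          CG * θ₂ * Λ * P o * ∑ y'' : S', Real.exp (-(δ₀ * dist (oblk o) y'')) * Real.exp (-(δ₀ * dist y'' b)) := by
        rw [Finset.mul_sum]
    _ ≤ A₀ * P o * Real.exp (-(θ * dist (oblk o) b)) +
          CG * θ₂ * Λ * P o * (Cc * Real.exp (-(θ * dist (oblk o) b))) :=
        add_le_add le_rfl (mul_le_mul_of_nonneg_left (hConv (oblk o) b) hC)
    _ = (A₀ + CG * θ₂ * Λ * Cc) * P o * Real.exp (-(θ * dist (oblk o) b)) := by ring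

/-! ## Proposition 2.6, every entry: (2.91) + the located inputs ⇒ the printed shape -/

/-- **LEFT entries of (2.136)/(2.137)/(2.140) for sup sources, any output seminorm family** — (2.91) `Δ_aG₀ = I − R`
with `GΔ_a = I` gives G = G₀ + GR (`B6Prop26.fixedPoint_of_291`), then THEOREM A: the printed shape
O(1)·P(o)·e^{−δ₃d(y_o,y′)}|J| with δ₃ = (1−α)δ and O(1) = A c₁(α)(1 − θc₁(α))^{−1} explicit (P(o) = L^jη for |∇GJ|,
1 for |ΔGJ|, (L^jη)^{1−α}(‖ζ‖^ξ_α + |ζ|) for ‖ζ∇GJ‖_α, …).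
[cite: Balaban1984PropagatorsII, Prop. 2.6 (2.136)–(2.137) p.247] -/
theorem prop26_leftEntry_of_291 [Fintype X] [DecidableEq X] (blk : X → g.Site) (N : O → Seminorm ℝ (X → ℝ))
    (oblk : O → g.Site) (d : ℕ) (δ α θ A : ℝ) (P : O → ℝ)
    (hA : 0 ≤ A) (hP : ∀ o, 0 ≤ P o) (hθ : 0 ≤ θ) (hαδ : 0 ≤ (1 - α) * δ) (htri : Triangle254 g)
    (hrefl : ∀ y : g.Site, g.dist y y = 0) (hdnn : ∀ y y' : g.Site, 0 ≤ g.dist y y')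
    (h261 : Ineq261 d g δ α) (h263 : Ineq263 d g δ α) (hsmall : θ * B6.c1 d δ α < 1)
    {G G0 R Δa : Module.End ℝ (X → ℝ)} (hinv : G * Δa = 1) (h291 : Δa * G0 = 1 - R)
    (hG0 : GMajorant (blockSrc blk) N G0 (fun o b => A * P o * Real.exp (-(δ * g.dist (oblk o) b))))
    (hR : HasMajorant blk R (fun a b => θ * Real.exp (-(δ * g.dist a b)))) :
    GMajorant (blockSrc blk) N G
      (fun o b => A * B6.c1 d δ α * (1 - θ * B6.c1 d δ α)⁻¹ * P o *
        Real.exp (-((1 - α) * δ * g.dist (oblk o) b))) :=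
  gMajorant_of_fixedPoint blk N oblk d δ α θ A P hA hP hθ hαδ htri hrefl hdnn h261 h263 hsmall hG0 hR
    (fixedPoint_of_291 hinv h291)

/-- **EVERY entry of (2.136)–(2.140), general sources S, output seminorms N, right factor E** — from (2.91) with
`GΔ_a = I`; the (2.133)-type majorant A·P_G(o)·e^{−δd} of G₀ for sup sources and N-outputs and the (2.135)-majorant
θe^{−δd} of R (THEOREM A ⇒ K_G with C_G = A c₁(α)(1 − θc₁(α))^{−1}, rate (1−α)δ); the LOCAL n = 0 input: the majorant
A₀·P(o)·e^{−δd} of G₀E from S-sources to N-outputs; the LOCATED input: the majorant θ₂·Q(y)·e^{−δd} of RE from S-sources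
to sup outputs; ONE scale transfer P_G(o)Q(y″) ≤ Λe^{εd(y_o,y″)}P(o) and the (2.63)-type convolution at a rate δ₀ with
δ₀ + ε ≤ (1−α)δ, δ₀ ≤ δ, θ_c ≤ δ (THEOREMS B, C) ⟹ GE takes S-sources to N-outputs with the printed shape
O(1)·P(o)·e^{−θ_c d(y_o,y′)}, O(1) = A₀ + C_Gθ₂ΛC_c.
[cite: Balaban1984PropagatorsII, Prop. 2.6 (2.136)–(2.141) p.247] -/
theorem prop26_ioEntry_of_291 [Fintype X] [DecidableEq X] (blk : X → g.Site) (S : SourceClass g X)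
    (N : O → Seminorm ℝ (X → ℝ)) (oblk : O → g.Site) (d : ℕ) (δ α θ A : ℝ) (PG : O → ℝ)
    (A₀ θ₂ Λ ε δ₀ Cc θc : ℝ) (P : O → ℝ) (Q : g.Site → ℝ)
    (hA : 0 ≤ A) (hPG : ∀ o, 0 ≤ PG o) (hθ : 0 ≤ θ) (hαδ : 0 ≤ (1 - α) * δ) (htri : Triangle254 g)
    (hrefl : ∀ y : g.Site, g.dist y y = 0) (hdnn : ∀ y y' : g.Site, 0 ≤ g.dist y y')
    (h261 : Ineq261 d g δ α) (h263 : Ineq263 d g δ α) (hsmall : θ * B6.c1 d δ α < 1)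
    (hA₀ : 0 ≤ A₀) (hθ₂ : 0 ≤ θ₂) (hΛ : 0 ≤ Λ) (hP : ∀ o, 0 ≤ P o) (hQ : ∀ y, 0 ≤ Q y)
    (htransfer : ∀ o y'', PG o * Q y'' ≤ Λ * Real.exp (ε * g.dist (oblk o) y'') * P o)
    (hδb : δ₀ + ε ≤ (1 - α) * δ) (hδc : δ₀ ≤ δ) (hθc : θc ≤ δ) (hConv : B6Cor28.Conv263 g.dist δ₀ Cc θc)
    {G G0 R Δa : Module.End ℝ (X → ℝ)} (E : Module.End ℝ (X → ℝ)) (hinv : G * Δa = 1)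
    (h291 : Δa * G0 = 1 - R)
    (hG0 : GMajorant (blockSrc blk) N G0 (fun o b => A * PG o * Real.exp (-(δ * g.dist (oblk o) b))))
    (hR : HasMajorant blk R (fun a b => θ * Real.exp (-(δ * g.dist a b))))
    (hG0E : GMajorant S N (G0 * E) (fun o b => A₀ * P o * Real.exp (-(δ * g.dist (oblk o) b))))
    (hRE : GMajorant S evalN (R * E) (fun x b => θ₂ * Q (blk x) * Real.exp (-(δ * g.dist (blk x) b)))) :
    GMajorant S N (G * E)
      (fun o b => (A₀ + A * B6.c1 d δ α * (1 - θ * B6.c1 d δ α)⁻¹ * θ₂ * Λ * Cc) * P o *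
        Real.exp (-(θc * g.dist (oblk o) b))) := by
  have hfix : G = G0 + G * R := fixedPoint_of_291 hinv h291
  have hG := gMajorant_of_fixedPoint blk N oblk d δ α θ A PG hA hPG hθ hαδ htri hrefl hdnn h261 h263 hsmall
    hG0 hR hfix
  have hCG : 0 ≤ A * B6.c1 d δ α * (1 - θ * B6.c1 d δ α)⁻¹ :=
    mul_nonneg (mul_nonneg hA (c1_nonneg d δ α)) (inv_nonneg.mpr (by linarith))
  have hB := gMajorant_rightFactor blk E hfix (fun a b => θ₂ * Q a * Real.exp (-(δ * g.dist a b))) hG hG0E hRE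
    (fun a b => mul_nonneg (mul_nonneg hθ₂ (hQ a)) (Real.exp_nonneg _))
  refine gMajorant_mono hB fun o b => ?_
  have hk := rightFactor_kernel g.dist oblk P PG Q A₀ (A * B6.c1 d δ α * (1 - θ * B6.c1 d δ α)⁻¹) θ₂ Λ ε δ
    ((1 - α) * δ) δ δ₀ Cc θc hA₀ hCG hθ₂ hΛ hP hPG hQ hdnn htransfer hδb hδc hθc hConv o b
  refine le_trans (le_of_eq ?_) (le_trans hk (le_of_eq (by ring)))
  exact congrArg₂ (· + ·) rfl (Finset.sum_congr rfl fun y'' _ => by ring)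

/-- **The entry |(G∇*J)(x)| ≤ O(1)L^jη e^{−δ₃d(y,y′)}|J| of (2.136)** (third entry of the printed table, the one NOT
of left-factor form), on pv08's carrier `HasMajorant`: from (2.91) with `GΔ_a = I`, the (2.133)-type majorant
A(L^jη)²e^{−δd} of G₀ and the (2.135)-majorant θe^{−δd} of R (sup sources), the LOCAL bound A₀L^jη e^{−δd} of G₀∇*
(Prop. 2.5: (1.110)–(1.114) of [4] for the boxes, summed — hypothesis `hG0E`), the LOCATED bound θ₂(L^jη)^{−1}e^{−δd}
of R∇* (not printed; hypothesis `hRE`), the scale transfer L^jη ≤ Λe^{εd(y,y″)}L^{j″}η ((2.60), `B6Cor28.TransferR`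
with q = 1) and the convolution (2.63) at a rate δ₀ (δ₀ + ε ≤ (1−α)δ, δ₀ ≤ δ, θ_c ≤ δ), under Lemma 2.1 at rate δ,
(2.54), d(y,y) = 0, d ≥ 0, 1 ≤ L, 0 < η and θc₁(α) < 1: G∇* has the majorant (A₀ + A c₁(α)(1 − θc₁(α))^{−1}θ₂ΛC_c)
·L^jη·e^{−θ_c d(y,y′)} — the printed entry with δ₃ = θ_c and O(1) explicit.
[cite: Balaban1984PropagatorsII, Prop. 2.6 (2.136) p.247] -/
theorem prop26_entry3_of_291 [Fintype X] [DecidableEq X] (blk : X → g.Site) (d : ℕ) (δ α θ A : ℝ)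
    (A₀ θ₂ Λ ε δ₀ Cc θc : ℝ)
    (hA : 0 ≤ A) (hθ : 0 ≤ θ) (hαδ : 0 ≤ (1 - α) * δ) (htri : Triangle254 g)
    (hrefl : ∀ y : g.Site, g.dist y y = 0) (hdnn : ∀ y y' : g.Site, 0 ≤ g.dist y y')
    (h261 : Ineq261 d g δ α) (h263 : Ineq263 d g δ α) (hsmall : θ * B6.c1 d δ α < 1)
    (hA₀ : 0 ≤ A₀) (hθ₂ : 0 ≤ θ₂) (hΛ : 0 ≤ Λ) (hL : 1 ≤ g.L) (hη : 0 < g.eta)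
    (htransfer : ∀ a b : g.Site, g.len a ≤ Λ * Real.exp (ε * g.dist a b) * g.len b)
    (hδb : δ₀ + ε ≤ (1 - α) * δ) (hδc : δ₀ ≤ δ) (hθc : θc ≤ δ) (hConv : B6Cor28.Conv263 g.dist δ₀ Cc θc)
    {G G0 R Δa : Module.End ℝ (X → ℝ)} (E : Module.End ℝ (X → ℝ)) (hinv : G * Δa = 1)
    (h291 : Δa * G0 = 1 - R)
    (hG0 : HasMajorant blk G0 (fun a b => A * g.len a ^ 2 * Real.exp (-(δ * g.dist a b))))
    (hR : HasMajorant blk R (fun a b => θ * Real.exp (-(δ * g.dist a b))))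
    (hG0E : HasMajorant blk (G0 * E) (fun a b => A₀ * g.len a * Real.exp (-(δ * g.dist a b))))
    (hRE : HasMajorant blk (R * E) (fun a b => θ₂ * (g.len a)⁻¹ * Real.exp (-(δ * g.dist a b)))) :
    HasMajorant blk (G * E)
      (fun a b => (A₀ + A * B6.c1 d δ α * (1 - θ * B6.c1 d δ α)⁻¹ * θ₂ * Λ * Cc) * g.len a *
        Real.exp (-(θc * g.dist a b))) := by
  have hlen : ∀ y : g.Site, 0 < g.len y := B6Cor28.len_pos g hL hη
  rw [hasMajorant_iff]
  refine prop26_ioEntry_of_291 blk (blockSrc blk) evalN blk d δ α θ A (fun x => g.len (blk x) ^ 2) A₀ θ₂ Λ ε δ₀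
    Cc θc (fun x => g.len (blk x)) (fun y => (g.len y)⁻¹) hA (fun x => pow_nonneg (hlen _).le 2) hθ hαδ htri hrefl
    hdnn h261 h263 hsmall hA₀ hθ₂ hΛ (fun x => (hlen _).le) (fun y => inv_nonneg.mpr (hlen y).le) ?_ hδb hδc hθc
    hConv E hinv h291 ((hasMajorant_iff blk G0 _).mp hG0) hR ((hasMajorant_iff blk (G0 * E) _).mp hG0E)
    ((hasMajorant_iff blk (R * E) _).mp hRE)
  -- the transfer (L^jη)²(L^{j″}η)^{−1} ≤ Λe^{εd(y,y″)}L^jη from L^jη ≤ Λe^{εd(y,y″)}L^{j″}η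
  intro x y''
  have hy := hlen y''
  have h := mul_le_mul_of_nonneg_right (htransfer (blk x) y'')
    (mul_nonneg (hlen (blk x)).le (inv_nonneg.mpr hy.le))
  calc g.len (blk x) ^ 2 * (g.len y'')⁻¹ = g.len (blk x) * (g.len (blk x) * (g.len y'')⁻¹) := by ring
    _ ≤ Λ * Real.exp (ε * g.dist (blk x) y'') * g.len y'' * (g.len (blk x) * (g.len y'')⁻¹) := h
    _ = Λ * Real.exp (ε * g.dist (blk x) y'') * g.len (blk x) * (g.len y'' * (g.len y'')⁻¹) := by ring
    _ = Λ * Real.exp (ε * g.dist (blk x) y'') * g.len (blk x) := by rw [mul_inv_cancel₀ hy.ne', mul_one]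

/-! ## Lemma 2.1 taken from the tree (`B6.Lemma21Printed`), at the two rates the argument uses -/

/-- **EVERY entry, over the carrier of `…B6`, with Lemma 2.1 TAKEN FROM THE TREE at two rates.**  For a geometry of a
family satisfying `B6.Lemma21Printed` at the rate δ of the majorants (parameter α: (2.61), (2.63) for THEOREM A) AND at
a second rate r (parameter α′: (2.63) with one intermediate point for THEOREM C), under (2.1)–(2.2), (2.59) at both
(rate, parameter) pairs, (2.54), d(y,y) = 0, d ≥ 0 and the rate budget r + ε ≤ (1−α)δ (0 ≤ r, ε; the paper's
successive halvings δ₀ → ½δ₀ → …): the hypotheses (2.61)/(2.63)/`Conv263` of `prop26_ioEntry_of_291` are DISCHARGED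
(`B6RandomWalk.ineq263_of_261`, `B6Cor28.conv263_of_ineq263`); the scale transfer stays an explicit hypothesis (it is
entry-specific; for |(G∇*J)(x)| it is discharged from (2.60) in `prop26_entry3_of_lemma21`).  Final rate (1−α′)r,
O(1) = A₀ + A c₁(d,δ,α)(1 − θc₁(d,δ,α))^{−1}θ₂Λc₁(d,r,α′)².
[cite: Balaban1984PropagatorsII, Prop. 2.6 p.247; Lemma 2.1 p.234] -/
theorem prop26_ioEntry_of_lemma21 {I : Type} (d : ℕ) (δ r : ℝ) (hδ : 0 ≤ δ) (hr : 0 ≤ r) (geo : I → B6.Geometry)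
    (h21 : B6.Lemma21Printed d δ geo) (h21r : B6.Lemma21Printed d r geo) (i : I) (htri : Triangle254 (geo i))
    (hrefl : ∀ y : (geo i).Site, (geo i).dist y y = 0) (hdnn : ∀ y y' : (geo i).Site, 0 ≤ (geo i).dist y y')
    (hH : (geo i).Hyp21_22) (α α' : ℝ) (hα0 : 0 < α) (hα1 : α < 1) (hα'0 : 0 < α') (hα'1 : α' < 1)
    (h259 : B6.Cond259 d δ α (geo i).R (geo i).M) (h259r : B6.Cond259 d r α' (geo i).R (geo i).M)
    (ε : ℝ) (hε : 0 ≤ ε) (hrate : r + ε ≤ (1 - α) * δ)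
    {X O : Type} [Fintype X] [DecidableEq X] (blk : X → (geo i).Site) (S : SourceClass (geo i) X)
    (N : O → Seminorm ℝ (X → ℝ)) (oblk : O → (geo i).Site) (θ A A₀ θ₂ Λ : ℝ) (PG P : O → ℝ)
    (Q : (geo i).Site → ℝ) (hA : 0 ≤ A) (hPG : ∀ o, 0 ≤ PG o) (hθ : 0 ≤ θ) (hA₀ : 0 ≤ A₀) (hθ₂ : 0 ≤ θ₂)
    (hΛ : 0 ≤ Λ) (hP : ∀ o, 0 ≤ P o) (hQ : ∀ y, 0 ≤ Q y) (hsmall : θ * B6.c1 d δ α < 1)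
    (htransfer : ∀ o y'', PG o * Q y'' ≤ Λ * Real.exp (ε * (geo i).dist (oblk o) y'') * P o)
    {G G0 R Δa : Module.End ℝ (X → ℝ)} (E : Module.End ℝ (X → ℝ)) (hinv : G * Δa = 1)
    (h291 : Δa * G0 = 1 - R)
    (hG0 : GMajorant (blockSrc blk) N G0 (fun o b => A * PG o * Real.exp (-(δ * (geo i).dist (oblk o) b))))
    (hR : HasMajorant blk R (fun a b => θ * Real.exp (-(δ * (geo i).dist a b))))
    (hG0E : GMajorant S N (G0 * E) (fun o b => A₀ * P o * Real.exp (-(δ * (geo i).dist (oblk o) b))))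
    (hRE : GMajorant S evalN (R * E)
      (fun x b => θ₂ * Q (blk x) * Real.exp (-(δ * (geo i).dist (blk x) b)))) :
    GMajorant S N (G * E)
      (fun o b => (A₀ + A * B6.c1 d δ α * (1 - θ * B6.c1 d δ α)⁻¹ * θ₂ * Λ * B6.c1 d r α' ^ 2) * P o *
        Real.exp (-((1 - α') * r * (geo i).dist (oblk o) b))) := by
  have h261 : Ineq261 d (geo i) δ α := ((lemma21Printed_iff d δ geo).mp h21 i hH α hα0 hα1 h259).2
  have h263 : Ineq263 d (geo i) δ α := ineq263_of_261 d (geo i) δ α htri hδ hα1.le h261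
  have h261r : Ineq261 d (geo i) r α' := ((lemma21Printed_iff d r geo).mp h21r i hH α' hα'0 hα'1 h259r).2
  have h263r : Ineq263 d (geo i) r α' := ineq263_of_261 d (geo i) r α' htri hr hα'1.le h261r
  have hConv := B6Cor28.conv263_of_ineq263 d (geo i) r α' h263r
  have hαδ : 0 ≤ (1 - α) * δ := mul_nonneg (by linarith) hδ
  have hδc : r ≤ δ := by nlinarith
  have hθc : (1 - α') * r ≤ δ := by nlinarith
  exact prop26_ioEntry_of_291 blk S N oblk d δ α θ A PG A₀ θ₂ Λ ε r (B6.c1 d r α' ^ 2) ((1 - α') * r) P Q hA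
    hPG hθ hαδ htri hrefl hdnn h261 h263 hsmall hA₀ hθ₂ hΛ hP hQ htransfer hrate hδc hθc hConv E hinv h291 hG0
    hR hG0E hRE

/-- **|(G∇*J)(x)| ≤ O(1)L^jη e^{−δ₃d(y,y′)}|J| over the carrier of `…B6`, everything but the four majorants
DISCHARGED from the tree's typed Lemma 2.1** — (2.61)/(2.63) at rate δ (parameter α), (2.63) at rate r (parameter α′)
and the scale transfer L^jη ≤ L·e^{α′r d(y,y″)}·L^{j″}η from (2.60) at rate α′r (`B6Cor28.transfer_of_260`, q = 1,
under the largeness L ≤ e^{α′rRM}), for a geometry of a family satisfying `B6.Lemma21Printed` at δ and at r, under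
(2.1)–(2.2), (2.59) twice, (2.54), d(y,y) = 0, d ≥ 0, 1 ≤ L, 0 < η, θc₁(d,δ,α) < 1 and the rate budget
r + α′r ≤ (1−α)δ.  Delivered: δ₃ = (1−α′)r and O(1) = A₀ + A c₁(d,δ,α)(1 − θc₁(d,δ,α))^{−1}θ₂·L·c₁(d,r,α′)² —
"depending on d and L only" exactly insofar as A, A₀ (Prop. 2.5), θ, θ₂ (the O(M^{−1}) of (2.135) and of the R∇*
bound) and the fixed α, α′, r do.
[cite: Balaban1984PropagatorsII, Prop. 2.6 (2.136) p.247; Lemma 2.1 (2.60)–(2.63) p.234] -/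
theorem prop26_entry3_of_lemma21 {I : Type} (d : ℕ) (δ r : ℝ) (hδ : 0 ≤ δ) (hr : 0 ≤ r) (geo : I → B6.Geometry)
    (h21 : B6.Lemma21Printed d δ geo) (h21r : B6.Lemma21Printed d r geo) (i : I) (htri : Triangle254 (geo i))
    (hrefl : ∀ y : (geo i).Site, (geo i).dist y y = 0) (hdnn : ∀ y y' : (geo i).Site, 0 ≤ (geo i).dist y y')
    (hH : (geo i).Hyp21_22) (α α' : ℝ) (hα0 : 0 < α) (hα1 : α < 1) (hα'0 : 0 < α') (hα'1 : α' < 1)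
    (h259 : B6.Cond259 d δ α (geo i).R (geo i).M) (h259r : B6.Cond259 d r α' (geo i).R (geo i).M)
    (hL : 1 ≤ (geo i).L) (hη : 0 < (geo i).eta) (hlarge : (geo i).L ≤ Real.exp (α' * r * (geo i).R * (geo i).M))
    (hrate : r + α' * r ≤ (1 - α) * δ)
    {X : Type} [Fintype X] [DecidableEq X] (blk : X → (geo i).Site) (θ A A₀ θ₂ : ℝ)
    (hA : 0 ≤ A) (hθ : 0 ≤ θ) (hA₀ : 0 ≤ A₀) (hθ₂ : 0 ≤ θ₂) (hsmall : θ * B6.c1 d δ α < 1)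
    {G G0 R Δa : Module.End ℝ (X → ℝ)} (E : Module.End ℝ (X → ℝ)) (hinv : G * Δa = 1)
    (h291 : Δa * G0 = 1 - R)
    (hG0 : HasMajorant blk G0 (fun a b => A * (geo i).len a ^ 2 * Real.exp (-(δ * (geo i).dist a b))))
    (hR : HasMajorant blk R (fun a b => θ * Real.exp (-(δ * (geo i).dist a b))))
    (hG0E : HasMajorant blk (G0 * E) (fun a b => A₀ * (geo i).len a * Real.exp (-(δ * (geo i).dist a b))))
    (hRE : HasMajorant blk (R * E)
      (fun a b => θ₂ * ((geo i).len a)⁻¹ * Real.exp (-(δ * (geo i).dist a b)))) :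
    HasMajorant blk (G * E)
      (fun a b => (A₀ + A * B6.c1 d δ α * (1 - θ * B6.c1 d δ α)⁻¹ * θ₂ * (geo i).L * B6.c1 d r α' ^ 2) *
        (geo i).len a * Real.exp (-((1 - α') * r * (geo i).dist a b))) := by
  have h261 : Ineq261 d (geo i) δ α := ((lemma21Printed_iff d δ geo).mp h21 i hH α hα0 hα1 h259).2
  have h263 : Ineq263 d (geo i) δ α := ineq263_of_261 d (geo i) δ α htri hδ hα1.le h261
  have h260r : Ineq260 (geo i) r α' := ((lemma21Printed_iff d r geo).mp h21r i hH α' hα'0 hα'1 h259r).1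
  have h261r : Ineq261 d (geo i) r α' := ((lemma21Printed_iff d r geo).mp h21r i hH α' hα'0 hα'1 h259r).2
  have h263r : Ineq263 d (geo i) r α' := ineq263_of_261 d (geo i) r α' htri hr hα'1.le h261r
  have hConv := B6Cor28.conv263_of_ineq263 d (geo i) r α' h263r
  have hαδ : 0 ≤ (1 - α) * δ := mul_nonneg (by linarith) hδ
  have hε : 0 ≤ α' * r := mul_nonneg hα'0.le hr
  have hδc : r ≤ δ := by nlinarith
  have hθc : (1 - α') * r ≤ δ := by nlinarith
  -- the transfer from (2.60) at rate α′r with q = 1: L^jη ≤ L e^{α′r d(y,y″)} L^{j″}η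
  have e1 : |(1 : ℝ)| = 1 := abs_one
  have hl1 : (geo i).L ^ |(1 : ℝ)| ≤ Real.exp (α' * r * (geo i).R * (geo i).M) := by
    rw [e1, Real.rpow_one]; exact hlarge
  have hT := (B6Cor28.transfer_of_260 (geo i).scale (geo i).dist (geo i).L (geo i).eta (α' * r) (geo i).R
    (geo i).M (1 : ℝ) hL hη hl1 h260r).1
  rw [e1, ← B6Cor28.len_eq_rpow] at hT
  have htransfer : ∀ a b : (geo i).Site,
      (geo i).len a ≤ (geo i).L * Real.exp (α' * r * (geo i).dist a b) * (geo i).len b := by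
    intro a b
    have h := hT a b
    simp only [Real.rpow_one] at h
    exact h
  exact prop26_entry3_of_291 blk d δ α θ A A₀ θ₂ (geo i).L (α' * r) r (B6.c1 d r α' ^ 2) ((1 - α') * r) hA hθ
    hαδ htri hrefl hdnn h261 h263 hsmall hA₀ hθ₂ (le_trans zero_le_one hL) hL hη htransfer hrate hδc hθc hConv E
    hinv h291 hG0 hR hG0E hRE

/-- **The whole printed table (2.136) at once** — |(GJ)(x)|, |(∇GJ)(x)|, |(G∇*J)(x)|, |(ΔGJ)(x)| ≤
O(1)[(L^jη)², L^jη, L^jη, 1]e^{−δ₃d(y,y′)}|J| (`B6.pref4`), for sup sources on pv08's carrier: the entries n = 0, 1, 3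
are LEFT factors D₀ = 1, D₁, D₃ (unit pv01's `B6Prop26.prop26_three_entries_of_lemma21`, rate (1−α)δ), the entry
n = 2 is the RIGHT factor E (`prop26_entry3_of_lemma21`, rate (1−α′)r); both weakened to the common rate
δ₃ = (1−α′)r ≤ (1−α)δ and the common constant O(1) = A₀ + A c₁(d,δ,α)(1 − θc₁(d,δ,α))^{−1}(1 + θ₂·L·c₁(d,r,α′)²).
Inputs: (2.91) with GΔ_a = I; the majorants A·[(L^jη)², L^jη, ·, 1]·e^{−δd} of D_nG₀ (n ≠ 2), θe^{−δd} of R,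
A₀L^jη e^{−δd} of G₀E, θ₂(L^jη)^{−1}e^{−δd} of RE (all HYPOTHESES, located); Lemma 2.1 from the tree at the rates δ
and r; (2.54), d(y,y) = 0, d ≥ 0, 1 ≤ L, 0 < η, L ≤ e^{α′rRM}, r + α′r ≤ (1−α)δ, θc₁(d,δ,α) < 1.
[cite: Balaban1984PropagatorsII, Prop. 2.6 (2.136) p.247] -/
theorem prop26_table2136_of_lemma21 {I : Type} (d : ℕ) (δ r : ℝ) (hδ : 0 ≤ δ) (hr : 0 ≤ r)
    (geo : I → B6.Geometry) (h21 : B6.Lemma21Printed d δ geo) (h21r : B6.Lemma21Printed d r geo) (i : I)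
    (htri : Triangle254 (geo i)) (hrefl : ∀ y : (geo i).Site, (geo i).dist y y = 0)
    (hdnn : ∀ y y' : (geo i).Site, 0 ≤ (geo i).dist y y') (hH : (geo i).Hyp21_22) (α α' : ℝ) (hα0 : 0 < α)
    (hα1 : α < 1) (hα'0 : 0 < α') (hα'1 : α' < 1) (h259 : B6.Cond259 d δ α (geo i).R (geo i).M)
    (h259r : B6.Cond259 d r α' (geo i).R (geo i).M) (hL : 1 ≤ (geo i).L) (hη : 0 < (geo i).eta)
    (hlarge : (geo i).L ≤ Real.exp (α' * r * (geo i).R * (geo i).M)) (hrate : r + α' * r ≤ (1 - α) * δ)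
    {X : Type} [Fintype X] [DecidableEq X] (blk : X → (geo i).Site) (θ A A₀ θ₂ : ℝ)
    (hA : 0 ≤ A) (hθ : 0 ≤ θ) (hA₀ : 0 ≤ A₀) (hθ₂ : 0 ≤ θ₂) (hsmall : θ * B6.c1 d δ α < 1)
    {G G0 R Δa : Module.End ℝ (X → ℝ)} (D : Fin 4 → Module.End ℝ (X → ℝ)) (hD0 : D 0 = 1)
    (E : Module.End ℝ (X → ℝ)) (hinv : G * Δa = 1) (h291 : Δa * G0 = 1 - R)
    (hDG0 : ∀ n : Fin 4, n ≠ 2 → HasMajorant blk (D n * G0)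
      (fun a b => A * B6.pref4 ((geo i).len a) n * Real.exp (-(δ * (geo i).dist a b))))
    (hR : HasMajorant blk R (fun a b => θ * Real.exp (-(δ * (geo i).dist a b))))
    (hG0E : HasMajorant blk (G0 * E) (fun a b => A₀ * (geo i).len a * Real.exp (-(δ * (geo i).dist a b))))
    (hRE : HasMajorant blk (R * E)
      (fun a b => θ₂ * ((geo i).len a)⁻¹ * Real.exp (-(δ * (geo i).dist a b)))) :
    (∀ n : Fin 4, n ≠ 2 → HasMajorant blk (D n * G)
      (fun a b => (A₀ + A * B6.c1 d δ α * (1 - θ * B6.c1 d δ α)⁻¹ *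
          (1 + θ₂ * (geo i).L * B6.c1 d r α' ^ 2)) * B6.pref4 ((geo i).len a) n *
        Real.exp (-((1 - α') * r * (geo i).dist a b)))) ∧
    HasMajorant blk (G * E)
      (fun a b => (A₀ + A * B6.c1 d δ α * (1 - θ * B6.c1 d δ α)⁻¹ *
          (1 + θ₂ * (geo i).L * B6.c1 d r α' ^ 2)) * B6.pref4 ((geo i).len a) 2 *
        Real.exp (-((1 - α') * r * (geo i).dist a b))) := by
  have hlen : ∀ y : (geo i).Site, 0 < (geo i).len y := B6Cor28.len_pos (geo i) hL hη
  have hpref : ∀ (n : Fin 4) (y : (geo i).Site), 0 ≤ B6.pref4 ((geo i).len y) n := by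
    intro n y
    have h := (hlen y).le
    fin_cases n <;> simp [B6.pref4] <;> positivity
  have hC₁ : 0 ≤ A * B6.c1 d δ α * (1 - θ * B6.c1 d δ α)⁻¹ :=
    mul_nonneg (mul_nonneg hA (c1_nonneg d δ α)) (inv_nonneg.mpr (by linarith))
  have hextra : 0 ≤ θ₂ * (geo i).L * B6.c1 d r α' ^ 2 :=
    mul_nonneg (mul_nonneg hθ₂ (le_trans zero_le_one hL)) (pow_nonneg (c1_nonneg d r α') 2)
  have hrates : (1 - α') * r ≤ (1 - α) * δ := by nlinarith
  have hleft := (prop26_three_entries_of_lemma21 d δ hδ geo h21 i htri hrefl hdnn hH α hα0 hα1 h259 hL hη blk θ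
    A hA hθ hsmall D hD0 hinv h291 hDG0 hR).2
  have hright := prop26_entry3_of_lemma21 d δ r hδ hr geo h21 h21r i htri hrefl hdnn hH α α' hα0 hα1 hα'0 hα'1
    h259 h259r hL hη hlarge hrate blk θ A A₀ θ₂ hA hθ hA₀ hθ₂ hsmall E hinv h291
    (by simpa [B6.pref4, hD0] using hDG0 0) hR hG0E hRE
  refine ⟨fun n hn => hasMajorant_mono blk (hleft n hn) fun a b => ?_, hasMajorant_mono blk hright fun a b => ?_⟩
  · have hw := B6Cor28.exp_weaken_le ((1 - α) * δ) ((1 - α') * r) ((geo i).dist a b) hrates (hdnn a b)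
    have hc : A * B6.c1 d δ α * (1 - θ * B6.c1 d δ α)⁻¹ ≤ A₀ + A * B6.c1 d δ α * (1 - θ * B6.c1 d δ α)⁻¹ *
        (1 + θ₂ * (geo i).L * B6.c1 d r α' ^ 2) := by nlinarith
    calc A * B6.c1 d δ α * (1 - θ * B6.c1 d δ α)⁻¹ * B6.pref4 ((geo i).len a) n *
          Real.exp (-((1 - α) * δ * (geo i).dist a b))
        ≤ A * B6.c1 d δ α * (1 - θ * B6.c1 d δ α)⁻¹ * B6.pref4 ((geo i).len a) n *
          Real.exp (-((1 - α') * r * (geo i).dist a b)) :=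
          mul_le_mul_of_nonneg_left hw (mul_nonneg hC₁ (hpref n a))
      _ ≤ _ := mul_le_mul_of_nonneg_right (mul_le_mul_of_nonneg_right hc (hpref n a)) (Real.exp_nonneg _)
  · have h2 : B6.pref4 ((geo i).len a) 2 = (geo i).len a := by simp [B6.pref4]
    rw [h2]
    have hc : A₀ + A * B6.c1 d δ α * (1 - θ * B6.c1 d δ α)⁻¹ * θ₂ * (geo i).L * B6.c1 d r α' ^ 2 ≤
        A₀ + A * B6.c1 d δ α * (1 - θ * B6.c1 d δ α)⁻¹ * (1 + θ₂ * (geo i).L * B6.c1 d r α' ^ 2) := by nlinarith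
    exact mul_le_mul_of_nonneg_right (mul_le_mul_of_nonneg_right hc (hlen a).le) (Real.exp_nonneg _)

/-! ## The commutator arrangement for right factors: R E = E R♯ + R♭

For E = ∇* the operator RE = Σ K_{□,□′}G_{□′}h_{□′}∇* contains, through the commutator terms of K_{□,□′} ((2.92):
factors (∂h_□)·∂), the operator ∂G_{□′}h_{□′}∇*, whose pointwise bound for sup-sized sources is NOT uniform in the
lattice spacing ((2.138) needs ‖J‖^{ξ′}_ε).  The uniform arrangement moves that derivative onto the factor to the
left: on the lattice (∂h)·∂g = ∇*((∂h)g)-type + (∂²h)g-type terms, i.e. an operator identity RE = ER♯ + R♭ with R♯,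
R♭ bounded on sup sources (sizes O(M^{−1}) and O(M^{−1})(L^jη)^{−1}).  Then X = GE satisfies the fixed-point equation
X = (G₀E + GR♭) + XR♯ of the SAME shape as (2.141), and THEOREM A applies to X directly.  Both arrangements are
offered; which leaves are dischargeable from [4] is the reader's (cell GAPS.md G-pv01-6). -/

/-- The fixed-point equation of X = GE under a decomposition RE = ER♯ + R♭: `GE = (G₀E + GR♭) + (GE)R♯`.
[folklore] -/
theorem rightFactor_fixedPoint_comm {G G0 R Rs Rf : Module.End ℝ (X → ℝ)} (E : Module.End ℝ (X → ℝ))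
    (hfix : G = G0 + G * R) (hdec : R * E = E * Rs + Rf) : G * E = (G0 * E + G * Rf) + G * E * Rs := by
  have h := right_mul_fixedPoint E hfix
  rw [hdec, mul_add, ← mul_assoc] at h
  calc G * E = G0 * E + (G * E * Rs + G * Rf) := h
    _ = (G0 * E + G * Rf) + G * E * Rs := by abel

/-- The scale transfer used for the entry |(G∇*J)(x)|: from L^jη ≤ Λe^{εd(y,y″)}L^{j″}η ((2.60), q = 1) the mismatched
powers (L^jη)²·(L^{j″}η)^{−1} at the intermediate block are at most Λe^{εd(y,y″)}·L^jη. [folklore] -/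
theorem len_transfer_sq_inv (ℓ : g.Site → ℝ) (Λ ε : ℝ) (hℓ : ∀ y, 0 < ℓ y)
    (hT : ∀ a b : g.Site, ℓ a ≤ Λ * Real.exp (ε * g.dist a b) * ℓ b) (a y'' : g.Site) :
    ℓ a ^ 2 * (ℓ y'')⁻¹ ≤ Λ * Real.exp (ε * g.dist a y'') * ℓ a := by
  have hy := hℓ y''
  have h := mul_le_mul_of_nonneg_right (hT a y'') (mul_nonneg (hℓ a).le (inv_nonneg.mpr hy.le))
  calc ℓ a ^ 2 * (ℓ y'')⁻¹ = ℓ a * (ℓ a * (ℓ y'')⁻¹) := by ring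
    _ ≤ Λ * Real.exp (ε * g.dist a y'') * ℓ y'' * (ℓ a * (ℓ y'')⁻¹) := h
    _ = Λ * Real.exp (ε * g.dist a y'') * ℓ a * (ℓ y'' * (ℓ y'')⁻¹) := by ring
    _ = Λ * Real.exp (ε * g.dist a y'') * ℓ a := by rw [mul_inv_cancel₀ hy.ne', mul_one]

/-- **EVERY entry with a right factor, commutator arrangement** (sup sources, output seminorms N): from (2.91) with
GΔ_a = I, the located decomposition `R * E = E * R♯ + R♭`, the (2.133)-type majorant A·P_G(o)·e^{−δd} of G₀ and the
(2.135)-majorant θe^{−δd} of R (THEOREM A at rate δ ⇒ K_G), the n = 0 input A₀·P(o)·e^{−δd} of G₀E, the located sup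
majorant θ♭·Q(y)·e^{−δd} of R♭, one scale transfer and one (2.63)-convolution at a rate δ₀ (THEOREM C ⇒ G₀E + GR♭ has
the (sup → N) majorant (A₀ + C_Gθ♭ΛC_c)·P(o)·e^{−θ_c d}), and the located sup majorant θ♯e^{−θ_c d} of R♯ with
Lemma 2.1 at the rate θ_c (parameter α♯) and θ♯c₁(d,θ_c,α♯) < 1 (THEOREM A again, now for X = GE): GE takes sup
sources to N-outputs with majorant (A₀ + C_Gθ♭ΛC_c)·c₁(d,θ_c,α♯)(1 − θ♯c₁(d,θ_c,α♯))^{−1}·P(o)·e^{−(1−α♯)θ_c d(y_o,y′)}.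
[cite: Balaban1984PropagatorsII, Prop. 2.6 (2.136)–(2.141) p.247; (2.92) p.239] -/
theorem prop26_ioEntry_comm_of_291 [Fintype X] [DecidableEq X] (blk : X → g.Site) (N : O → Seminorm ℝ (X → ℝ))
    (oblk : O → g.Site) (d : ℕ) (δ α θ A : ℝ) (PG : O → ℝ) (A₀ θf Λ ε δ₀ Cc θc : ℝ) (P : O → ℝ)
    (Q : g.Site → ℝ) (αs θs : ℝ)
    (hA : 0 ≤ A) (hPG : ∀ o, 0 ≤ PG o) (hθ : 0 ≤ θ) (hαδ : 0 ≤ (1 - α) * δ) (htri : Triangle254 g)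
    (hrefl : ∀ y : g.Site, g.dist y y = 0) (hdnn : ∀ y y' : g.Site, 0 ≤ g.dist y y')
    (h261 : Ineq261 d g δ α) (h263 : Ineq263 d g δ α) (hsmall : θ * B6.c1 d δ α < 1)
    (hA₀ : 0 ≤ A₀) (hθf : 0 ≤ θf) (hΛ : 0 ≤ Λ) (hP : ∀ o, 0 ≤ P o) (hQ : ∀ y, 0 ≤ Q y)
    (htransfer : ∀ o y'', PG o * Q y'' ≤ Λ * Real.exp (ε * g.dist (oblk o) y'') * P o)
    (hδb : δ₀ + ε ≤ (1 - α) * δ) (hδc : δ₀ ≤ δ) (hθc : θc ≤ δ) (hConv : B6Cor28.Conv263 g.dist δ₀ Cc θc)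
    (hCc : 0 ≤ Cc) (hθs : 0 ≤ θs) (hαθc : 0 ≤ (1 - αs) * θc) (h261c : Ineq261 d g θc αs)
    (h263c : Ineq263 d g θc αs) (hsmalls : θs * B6.c1 d θc αs < 1)
    {G G0 R Δa Rs Rf : Module.End ℝ (X → ℝ)} (E : Module.End ℝ (X → ℝ)) (hinv : G * Δa = 1)
    (h291 : Δa * G0 = 1 - R) (hdec : R * E = E * Rs + Rf)
    (hG0 : GMajorant (blockSrc blk) N G0 (fun o b => A * PG o * Real.exp (-(δ * g.dist (oblk o) b))))
    (hR : HasMajorant blk R (fun a b => θ * Real.exp (-(δ * g.dist a b))))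
    (hG0E : GMajorant (blockSrc blk) N (G0 * E) (fun o b => A₀ * P o * Real.exp (-(δ * g.dist (oblk o) b))))
    (hRf : HasMajorant blk Rf (fun a b => θf * Q a * Real.exp (-(δ * g.dist a b))))
    (hRs : HasMajorant blk Rs (fun a b => θs * Real.exp (-(θc * g.dist a b)))) :
    GMajorant (blockSrc blk) N (G * E)
      (fun o b => (A₀ + A * B6.c1 d δ α * (1 - θ * B6.c1 d δ α)⁻¹ * θf * Λ * Cc) * B6.c1 d θc αs *
        (1 - θs * B6.c1 d θc αs)⁻¹ * P o * Real.exp (-((1 - αs) * θc * g.dist (oblk o) b))) := by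
  have hfix : G = G0 + G * R := fixedPoint_of_291 hinv h291
  have hG := gMajorant_of_fixedPoint blk N oblk d δ α θ A PG hA hPG hθ hαδ htri hrefl hdnn h261 h263 hsmall
    hG0 hR hfix
  have hCG : 0 ≤ A * B6.c1 d δ α * (1 - θ * B6.c1 d δ α)⁻¹ :=
    mul_nonneg (mul_nonneg hA (c1_nonneg d δ α)) (inv_nonneg.mpr (by linarith))
  -- the "free term" B = G₀E + GR♭ of the fixed-point equation for X = GE
  have hRf' : GMajorant (blockSrc blk) evalN Rf
      (fun x => (fun a b => θf * Q a * Real.exp (-(δ * g.dist a b))) (blk x)) :=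
    (hasMajorant_iff blk Rf _).mp hRf
  have hB₀ := gMajorant_add hG0E (gMajorant_mul blk (K₂ := fun a b => θf * Q a * Real.exp (-(δ * g.dist a b)))
    hG hRf' (fun a b => mul_nonneg (mul_nonneg hθf (hQ a)) (Real.exp_nonneg _)))
  have hB : GMajorant (blockSrc blk) N (G0 * E + G * Rf)
      (fun o b => (A₀ + A * B6.c1 d δ α * (1 - θ * B6.c1 d δ α)⁻¹ * θf * Λ * Cc) * P o *
        Real.exp (-(θc * g.dist (oblk o) b))) := by
    refine gMajorant_mono hB₀ fun o b => ?_
    have hk := rightFactor_kernel g.dist oblk P PG Q A₀ (A * B6.c1 d δ α * (1 - θ * B6.c1 d δ α)⁻¹) θf Λ ε δ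
      ((1 - α) * δ) δ δ₀ Cc θc hA₀ hCG hθf hΛ hP hPG hQ hdnn htransfer hδb hδc hθc hConv o b
    refine le_trans (le_of_eq ?_) hk
    exact congrArg₂ (· + ·) rfl (Finset.sum_congr rfl fun y'' _ => by ring)
  have hBnn : 0 ≤ A₀ + A * B6.c1 d δ α * (1 - θ * B6.c1 d δ α)⁻¹ * θf * Λ * Cc :=
    add_nonneg hA₀ (mul_nonneg (mul_nonneg (mul_nonneg hCG hθf) hΛ) hCc)
  exact gMajorant_of_fixedPoint blk N oblk d θc αs θs _ P hBnn hP hθs hαθc htri hrefl hdnn h261c h263c hsmalls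
    hB hRs (rightFactor_fixedPoint_comm E hfix hdec)

/-- **The entry |(G∇*J)(x)| ≤ O(1)L^jη e^{−δ₃d(y,y′)}|J| by the commutator arrangement** (sup sources and outputs on
pv08's carrier): `prop26_ioEntry_comm_of_291` with P_G = (L^jη)², P = L^jη, Q = (L^jη)^{−1} and the transfer
(L^jη)²(L^{j″}η)^{−1} ≤ Λe^{εd}L^jη from L^jη ≤ Λe^{εd(y,y″)}L^{j″}η (`len_transfer_sq_inv`).  Located inputs
(HYPOTHESES): the majorants A(L^jη)²e^{−δd} of G₀ and θe^{−δd} of R ((2.133)/(2.135)), A₀L^jη e^{−δd} of G₀∇* (n = 0,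
Prop. 2.5), the decomposition R∇* = ∇*R♯ + R♭ with sup majorants θ♯e^{−θ_c d} of R♯ and θ♭(L^jη)^{−1}e^{−δd} of R♭.
[cite: Balaban1984PropagatorsII, Prop. 2.6 (2.136)₃/(2.141) p.247; (2.92) p.239] -/
theorem prop26_entry3_comm_of_291 [Fintype X] [DecidableEq X] (blk : X → g.Site) (d : ℕ) (δ α θ A : ℝ)
    (A₀ θf Λ ε δ₀ Cc θc αs θs : ℝ)
    (hA : 0 ≤ A) (hθ : 0 ≤ θ) (hαδ : 0 ≤ (1 - α) * δ) (htri : Triangle254 g)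
    (hrefl : ∀ y : g.Site, g.dist y y = 0) (hdnn : ∀ y y' : g.Site, 0 ≤ g.dist y y')
    (h261 : Ineq261 d g δ α) (h263 : Ineq263 d g δ α) (hsmall : θ * B6.c1 d δ α < 1)
    (hA₀ : 0 ≤ A₀) (hθf : 0 ≤ θf) (hΛ : 0 ≤ Λ) (hL : 1 ≤ g.L) (hη : 0 < g.eta)
    (htransfer : ∀ a b : g.Site, g.len a ≤ Λ * Real.exp (ε * g.dist a b) * g.len b)
    (hδb : δ₀ + ε ≤ (1 - α) * δ) (hδc : δ₀ ≤ δ) (hθc : θc ≤ δ) (hConv : B6Cor28.Conv263 g.dist δ₀ Cc θc)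
    (hCc : 0 ≤ Cc) (hθs : 0 ≤ θs) (hαθc : 0 ≤ (1 - αs) * θc) (h261c : Ineq261 d g θc αs)
    (h263c : Ineq263 d g θc αs) (hsmalls : θs * B6.c1 d θc αs < 1)
    {G G0 R Δa Rs Rf : Module.End ℝ (X → ℝ)} (E : Module.End ℝ (X → ℝ)) (hinv : G * Δa = 1)
    (h291 : Δa * G0 = 1 - R) (hdec : R * E = E * Rs + Rf)
    (hG0 : HasMajorant blk G0 (fun a b => A * g.len a ^ 2 * Real.exp (-(δ * g.dist a b))))
    (hR : HasMajorant blk R (fun a b => θ * Real.exp (-(δ * g.dist a b))))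
    (hG0E : HasMajorant blk (G0 * E) (fun a b => A₀ * g.len a * Real.exp (-(δ * g.dist a b))))
    (hRf : HasMajorant blk Rf (fun a b => θf * (g.len a)⁻¹ * Real.exp (-(δ * g.dist a b))))
    (hRs : HasMajorant blk Rs (fun a b => θs * Real.exp (-(θc * g.dist a b)))) :
    HasMajorant blk (G * E)
      (fun a b => (A₀ + A * B6.c1 d δ α * (1 - θ * B6.c1 d δ α)⁻¹ * θf * Λ * Cc) * B6.c1 d θc αs *
        (1 - θs * B6.c1 d θc αs)⁻¹ * g.len a * Real.exp (-((1 - αs) * θc * g.dist a b))) := by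
  have hlen : ∀ y : g.Site, 0 < g.len y := B6Cor28.len_pos g hL hη
  rw [hasMajorant_iff]
  exact prop26_ioEntry_comm_of_291 blk evalN blk d δ α θ A (fun x => g.len (blk x) ^ 2) A₀ θf Λ ε δ₀ Cc θc
    (fun x => g.len (blk x)) (fun y => (g.len y)⁻¹) αs θs hA (fun x => pow_nonneg (hlen _).le 2) hθ hαδ htri hrefl
    hdnn h261 h263 hsmall hA₀ hθf hΛ (fun x => (hlen _).le) (fun y => inv_nonneg.mpr (hlen y).le)
    (fun x y'' => len_transfer_sq_inv g.len Λ ε hlen htransfer (blk x) y'') hδb hδc hθc hConv hCc hθs hαθc h261c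
    h263c hsmalls E hinv h291 hdec ((hasMajorant_iff blk G0 _).mp hG0) hR
    ((hasMajorant_iff blk (G0 * E) _).mp hG0E) hRf hRs

/-- **The entry |(G∇*J)(x)| by the commutator arrangement, with Lemma 2.1 TAKEN FROM THE TREE at three rates**: the
rate δ of the majorants (parameter α, THEOREM A for G), a second rate r (parameter α′: the transfer from (2.60) with
q = 1 under L ≤ e^{α′rRM}, and the (2.63)-convolution, THEOREM C) and the third rate (1−α′)r (parameter α♯: THEOREM A
for X = G∇*), under (2.1)–(2.2), (2.59) at the three (rate, parameter) pairs, (2.54), d(y,y) = 0, d ≥ 0, 1 ≤ L, 0 < η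
and the rate budget r + α′r ≤ (1−α)δ.  Final rate (1−α♯)(1−α′)r; O(1) = (A₀ + A c₁(d,δ,α)(1 − θc₁(d,δ,α))^{−1}θ♭·L·
c₁(d,r,α′)²)·c₁(d,(1−α′)r,α♯)·(1 − θ♯c₁(d,(1−α′)r,α♯))^{−1}.
[cite: Balaban1984PropagatorsII, Prop. 2.6 (2.136)₃/(2.141) p.247; Lemma 2.1 p.234; (2.92) p.239] -/
theorem prop26_entry3_comm_of_lemma21 {I : Type} (d : ℕ) (δ r : ℝ) (hδ : 0 ≤ δ) (hr : 0 ≤ r)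
    (geo : I → B6.Geometry) (α α' αs : ℝ) (h21 : B6.Lemma21Printed d δ geo) (h21r : B6.Lemma21Printed d r geo)
    (h21c : B6.Lemma21Printed d ((1 - α') * r) geo) (i : I) (htri : Triangle254 (geo i))
    (hrefl : ∀ y : (geo i).Site, (geo i).dist y y = 0) (hdnn : ∀ y y' : (geo i).Site, 0 ≤ (geo i).dist y y')
    (hH : (geo i).Hyp21_22) (hα0 : 0 < α) (hα1 : α < 1) (hα'0 : 0 < α') (hα'1 : α' < 1)
    (hαs0 : 0 < αs) (hαs1 : αs < 1) (h259 : B6.Cond259 d δ α (geo i).R (geo i).M)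
    (h259r : B6.Cond259 d r α' (geo i).R (geo i).M) (h259c : B6.Cond259 d ((1 - α') * r) αs (geo i).R (geo i).M)
    (hL : 1 ≤ (geo i).L) (hη : 0 < (geo i).eta) (hlarge : (geo i).L ≤ Real.exp (α' * r * (geo i).R * (geo i).M))
    (hrate : r + α' * r ≤ (1 - α) * δ)
    {X : Type} [Fintype X] [DecidableEq X] (blk : X → (geo i).Site) (θ A A₀ θf θs : ℝ)
    (hA : 0 ≤ A) (hθ : 0 ≤ θ) (hA₀ : 0 ≤ A₀) (hθf : 0 ≤ θf) (hθs : 0 ≤ θs) (hsmall : θ * B6.c1 d δ α < 1)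
    (hsmalls : θs * B6.c1 d ((1 - α') * r) αs < 1)
    {G G0 R Δa Rs Rf : Module.End ℝ (X → ℝ)} (E : Module.End ℝ (X → ℝ)) (hinv : G * Δa = 1)
    (h291 : Δa * G0 = 1 - R) (hdec : R * E = E * Rs + Rf)
    (hG0 : HasMajorant blk G0 (fun a b => A * (geo i).len a ^ 2 * Real.exp (-(δ * (geo i).dist a b))))
    (hR : HasMajorant blk R (fun a b => θ * Real.exp (-(δ * (geo i).dist a b))))
    (hG0E : HasMajorant blk (G0 * E) (fun a b => A₀ * (geo i).len a * Real.exp (-(δ * (geo i).dist a b))))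
    (hRf : HasMajorant blk Rf (fun a b => θf * ((geo i).len a)⁻¹ * Real.exp (-(δ * (geo i).dist a b))))
    (hRs : HasMajorant blk Rs (fun a b => θs * Real.exp (-((1 - α') * r * (geo i).dist a b)))) :
    HasMajorant blk (G * E)
      (fun a b => (A₀ + A * B6.c1 d δ α * (1 - θ * B6.c1 d δ α)⁻¹ * θf * (geo i).L * B6.c1 d r α' ^ 2) *
        B6.c1 d ((1 - α') * r) αs * (1 - θs * B6.c1 d ((1 - α') * r) αs)⁻¹ * (geo i).len a *
        Real.exp (-((1 - αs) * ((1 - α') * r) * (geo i).dist a b))) := by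
  have h261 : Ineq261 d (geo i) δ α := ((lemma21Printed_iff d δ geo).mp h21 i hH α hα0 hα1 h259).2
  have h263 : Ineq263 d (geo i) δ α := ineq263_of_261 d (geo i) δ α htri hδ hα1.le h261
  have h260r : Ineq260 (geo i) r α' := ((lemma21Printed_iff d r geo).mp h21r i hH α' hα'0 hα'1 h259r).1
  have h261r : Ineq261 d (geo i) r α' := ((lemma21Printed_iff d r geo).mp h21r i hH α' hα'0 hα'1 h259r).2
  have h263r : Ineq263 d (geo i) r α' := ineq263_of_261 d (geo i) r α' htri hr hα'1.le h261r
  have hConv := B6Cor28.conv263_of_ineq263 d (geo i) r α' h263r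
  have hrc : 0 ≤ (1 - α') * r := mul_nonneg (by linarith) hr
  have h261c : Ineq261 d (geo i) ((1 - α') * r) αs :=
    ((lemma21Printed_iff d ((1 - α') * r) geo).mp h21c i hH αs hαs0 hαs1 h259c).2
  have h263c : Ineq263 d (geo i) ((1 - α') * r) αs := ineq263_of_261 d (geo i) ((1 - α') * r) αs htri hrc
    hαs1.le h261c
  have hαδ : 0 ≤ (1 - α) * δ := mul_nonneg (by linarith) hδ
  have hδc : r ≤ δ := by nlinarith
  have hθc : (1 - α') * r ≤ δ := by nlinarith
  have hαθc : 0 ≤ (1 - αs) * ((1 - α') * r) := mul_nonneg (by linarith) hrc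
  have hCc : 0 ≤ B6.c1 d r α' ^ 2 := pow_nonneg (c1_nonneg d r α') 2
  -- the transfer from (2.60) at rate α′r with q = 1: L^jη ≤ L e^{α′r d(y,y″)} L^{j″}η
  have e1 : |(1 : ℝ)| = 1 := abs_one
  have hl1 : (geo i).L ^ |(1 : ℝ)| ≤ Real.exp (α' * r * (geo i).R * (geo i).M) := by
    rw [e1, Real.rpow_one]; exact hlarge
  have hT := (B6Cor28.transfer_of_260 (geo i).scale (geo i).dist (geo i).L (geo i).eta (α' * r) (geo i).R
    (geo i).M (1 : ℝ) hL hη hl1 h260r).1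
  rw [e1, ← B6Cor28.len_eq_rpow] at hT
  have htransfer : ∀ a b : (geo i).Site,
      (geo i).len a ≤ (geo i).L * Real.exp (α' * r * (geo i).dist a b) * (geo i).len b := by
    intro a b
    have h := hT a b
    simp only [Real.rpow_one] at h
    exact h
  have h := prop26_entry3_comm_of_291 blk d δ α θ A A₀ θf (geo i).L (α' * r) r (B6.c1 d r α' ^ 2)
    ((1 - α') * r) αs θs hA hθ hαδ htri hrefl hdnn h261 h263 hsmall hA₀ hθf (le_trans zero_le_one hL) hL hη
    htransfer hrate hδc hθc hConv hCc hθs hαθc h261c h263c hsmalls E hinv h291 hdec hG0 hR hG0E hRf hRs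
  refine hasMajorant_mono blk h fun a b => le_of_eq ?_
  ring

end General

end Literature.MathematicalPhysics.QuantumFieldTheory.Balaban1983to89.B6Prop26Norms
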